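import Summits.HubbardSuperconductivity.HubbardSuperconductivity.Theorems.ThermalWedgeTwSeededEnsembleEquivalenceRSourcedPressureLimit
import Literature.MathematicalPhysics.QuantumLattice.SourcedHubbardBlockPartitionFunction
import Literature.MathematicalPhysics.QuantumLattice.FermionTorusBlockTiling

/-!
# Crux `TwSeededEnsembleEquivalenceR` (stmt-HubbardSuperconductivity-15581), line `cold-floor-collapse` (slug `Sketch`),
# skeleton v8 (block two-phase pinning) — registered stub `stub_blockProduct`

Support file (`--supports stmt-HubbardSuperconductivity-15581`; sorry-free; no definition).

**The two-phase trial Hamiltonian.** For the torus of side `L`, block side `1 ≤ M ≤ L`, `K = ⌊L/M⌋`, the `K²` open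
`M × M` blocks `c·M + [0,M)²` are embedded by order embeddings `f_c : Λ_M ↪o Λ_L` (`FermionTorus.exists_blockFamily`);
`a` of them form the set `TA`, the others `TB`, and `RR` is the thin remainder (`≤ 2LM` sites). The trial operator is
`T₀ = Σ_c (f_c)_* H_M(0) + V_{RR}(U, 0)` with `H_M(μ)` the d-wave-SOURCED free-boundary Hubbard Hamiltonian of the
`M`-box (hopping `1`, source `h`, weights `ĝ_d(y − x)/√2`), `SA, SB, SR` the orbitals of the `TA`-blocks, `TB`-blocks,
remainder. Then `K̃(μA, μB) = T₀ − μA N_A − μB N_B − μs N_R = Σ_{c ∈ TA} (f_c)_* H_M(μA) + Σ_{c ∈ TB} (f_c)_* H_M(μB) + V_{RR}(U, μs)`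
(`sum_jwEmbed_sourced_shift`), and:
(i) `log Z_β(K̃) = a log Z_β(Rect_M(μA)) + (K² − a) log Z_β(Rect_M(μB)) + #RR · log z₀(β, U, μs)`
(`log_partitionFn_blockSum`, `twR_box_partitionFn_eq_rect`), `0 ≤ #RR log z₀ ≤ 4(1 + β(U + |μs|)) LM`;
(ii) `Re⟨K_seed − K̃⟩_{K̃} ≤ h²L²/g + (μA − μs)Re⟨N_A⟩ + (μB − μs)Re⟨N_B⟩ + ‖W‖` with the AHM operator inequality
(`re_gibbsState_pairing_le`) and `W = (dWaveSourceTorus − H_L(μs)) + (H_L(μs) − Σ_c (f_c)_* H_M(μs) − V_{RR}(μs))`,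
`‖W‖ ≤ (8 + 192|h|)L + (2 + 4|h|) · 8L(2K + M + 1) ≤ 256(1 + |h|)(L²/M + LM)` (`norm_sourced_sub_sum_jwEmbed_sub_onSiteSum_le`,
`FermionTorus.card_boxAdj_not_sameBlock_le`, and the torus/box comparison `twR_norm_dWaveSourceTorus_sub_box_le`, extended
to `L ≤ 2` by a crude count);
(iii) `‖[N_A, [T₀, N_A]]‖ ≤ a · 16|h| Σ_z ‖w_M z‖ ≤ 64|h|L²` (`norm_doubleComm_blockSum_le`). Ruelle (1969) §2.2–2.3;
Bratteli–Robinson II §5.2.2; Dyson–Lieb–Simon (1978) §3. [folklore]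
-/

set_option linter.dupNamespace false

namespace Summit.HubbardSuperconductivity.HubbardSuperconductivity.Theorems.TwSeededEnsembleEquivalenceR.ColdFloorLine

open Matrix Filter Topology Finset Literature.MathematicalPhysics.QuantumLattice
open Literature.Barriers.HubbardSuperconductivity Literature.Probability.LatticeModels
open scoped ComplexOrder Matrix.Norms.L2Operator

noncomputable section

/-! ### Torus versus box for every `L ≥ 1`, and the box weights -/

/-- The free-boundary d-wave weights are nearest-neighbour weights bounded by `1`. [folklore] -/
private theorem bp_boxWeight_le (N : ℕ) (z : FermionTorus 2 N × FermionTorus 2 N) :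
    ‖(fun z : FermionTorus 2 N × FermionTorus 2 N => (((dWaveFormFactor ((fun i : Fin 2 => ((ofLex z.2 i : ℕ) : ℤ)) - (fun i : Fin 2 => ((ofLex z.1 i : ℕ) : ℤ))) / Real.sqrt 2 : ℝ) : ℂ))) z‖ ≤ if ((zdGraph 2).comap (fun x : FermionTorus 2 N => fun i : Fin 2 => ((ofLex x i : ℕ) : ℤ))).Adj z.1 z.2 then 1 else 0 := by
  show ‖(((dWaveFormFactor ((fun i : Fin 2 => ((ofLex z.2 i : ℕ) : ℤ)) - (fun i : Fin 2 => ((ofLex z.1 i : ℕ) : ℤ))) / Real.sqrt 2 : ℝ) : ℂ))‖ ≤ _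
  split_ifs with hadj
  · exact twR_dWaveKernel_norm_le _
  · rw [SimpleGraph.comap_adj] at hadj
    have h0 : (((dWaveFormFactor ((fun i : Fin 2 => ((ofLex z.2 i : ℕ) : ℤ)) - (fun i : Fin 2 => ((ofLex z.1 i : ℕ) : ℤ))) / Real.sqrt 2 : ℝ) : ℂ)) = 0 := by
      by_contra hne
      exact hadj (twR_dWaveKernel_adj _ _ hne)
    rw [h0, norm_zero]

/-- **`‖dWaveSourceTorus L U μ h − H_box‖ ≤ (8 + 192|h|)L` for every `L ≥ 1`** (`twR_norm_dWaveSourceTorus_sub_box_le`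
for `L ≥ 3`; for `L ≤ 2` the `≤ 6` pointwise weight difference on `L⁴ ≤ 8L` ordered pairs). [folklore] -/
private theorem bp_norm_torus_sub_box_le (L : ℕ) [NeZero L] (U μ h : ℝ) :
    ‖dWaveSourceTorus L U μ h - (hamiltonianWith ((zdGraph 2).comap (fun x : FermionTorus 2 L => fun i : Fin 2 => ((ofLex x i : ℕ) : ℤ))) 1 U μ - (h : ℂ) • ((∑ z : FermionTorus 2 L × FermionTorus 2 L, (fun z : FermionTorus 2 L × FermionTorus 2 L => (((dWaveFormFactor ((fun i : Fin 2 => ((ofLex z.2 i : ℕ) : ℤ)) - (fun i : Fin 2 => ((ofLex z.1 i : ℕ) : ℤ))) / Real.sqrt 2 : ℝ) : ℂ))) z • bondPair z.1 z.2) + (∑ z : FermionTorus 2 L × FermionTorus 2 L, (fun z : FermionTorus 2 L × FermionTorus 2 L => (((dWaveFormFactor ((fun i : Fin 2 => ((ofLex z.2 i : ℕ) : ℤ)) - (fun i : Fin 2 => ((ofLex z.1 i : ℕ) : ℤ))) / Real.sqrt 2 : ℝ) : ℂ))) z • bondPair z.1 z.2)ᴴ))‖ ≤ (8 + 192 * |h|)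 * L := by
  have hL0 : (0 : ℝ) ≤ L := Nat.cast_nonneg L
  rcases le_or_gt 3 L with hL | hL
  · refine (twR_norm_dWaveSourceTorus_sub_box_le hL U μ h).trans ?_
    nlinarith [abs_nonneg h]
  · -- `L ≤ 2`
    have hsplit : dWaveSourceTorus L U μ h - (hamiltonianWith ((zdGraph 2).comap (fun x : FermionTorus 2 L => fun i : Fin 2 => ((ofLex x i : ℕ) : ℤ))) 1 U μ - (h : ℂ) • ((∑ z : FermionTorus 2 L × FermionTorus 2 L, (fun z : FermionTorus 2 L × FermionTorus 2 L => (((dWaveFormFactor ((fun i : Fin 2 => ((ofLex z.2 i : ℕ) : ℤ)) - (fun i : Fin 2 => ((ofLex z.1 i : ℕ) : ℤ))) / Real.sqrt 2 : ℝ) : ℂ))) z • bondPair z.1 z.2) + (∑ z : FermionTorus 2 L × FermionTorus 2 L, (fun z : FermionTorus 2 L × FermionTorus 2 L => (((dWaveFormFactor ((fun i : Fin 2 => ((ofLex z.2 i : ℕ) : ℤ)) - (fun i : Fin 2 => ((ofLex z.1 i : ℕ) : ℤ))) / Real.sqrt 2 : ℝ) : ℂ))) z • bondPair z.1 z.2)ᴴ))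 =
        (hamiltonianWith (fermionTorusGraph 2 L) 1 U μ - hamiltonianWith ((zdGraph 2).comap (fun x : FermionTorus 2 L => fun i : Fin 2 => ((ofLex x i : ℕ) : ℤ))) 1 U μ) -
          (h : ℂ) • ((pairField dWaveFormFactor L - (∑ z : FermionTorus 2 L × FermionTorus 2 L, (fun z : FermionTorus 2 L × FermionTorus 2 L => (((dWaveFormFactor ((fun i : Fin 2 => ((ofLex z.2 i : ℕ) : ℤ)) - (fun i : Fin 2 => ((ofLex z.1 i : ℕ) : ℤ))) / Real.sqrt 2 : ℝ) : ℂ))) z • bondPair z.1 z.2)) +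
            (pairField dWaveFormFactor L - (∑ z : FermionTorus 2 L × FermionTorus 2 L, (fun z : FermionTorus 2 L × FermionTorus 2 L => (((dWaveFormFactor ((fun i : Fin 2 => ((ofLex z.2 i : ℕ) : ℤ)) - (fun i : Fin 2 => ((ofLex z.1 i : ℕ) : ℤ))) / Real.sqrt 2 : ℝ) : ℂ))) z • bondPair z.1 z.2))ᴴ) := by
      rw [dWaveSourceTorus, hubbardTorusWith]
      simp only [conjTranspose_sub, smul_add, smul_sub]
      abel
    rw [hsplit]
    have h1 := twR_norm_hamiltonianWith_torus_sub_box_le (L := L) U μ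
    -- the crude pair-field comparison
    have h2 : ‖pairField dWaveFormFactor L - (∑ z : FermionTorus 2 L × FermionTorus 2 L, (fun z : FermionTorus 2 L × FermionTorus 2 L => (((dWaveFormFactor ((fun i : Fin 2 => ((ofLex z.2 i : ℕ) : ℤ)) - (fun i : Fin 2 => ((ofLex z.1 i : ℕ) : ℤ))) / Real.sqrt 2 : ℝ) : ℂ))) z • bondPair z.1 z.2)‖ ≤ 96 * L := by
      rw [twR_pairField_eq_sum_bondPair dWaveFormFactor L, ← Finset.sum_sub_distrib]
      have hsub : ∀ z : FermionTorus 2 L × FermionTorus 2 L,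
          (fun z : FermionTorus 2 L × FermionTorus 2 L => ∑ e ∈ insert (0 : Site 2) unitSteps, (if FermionTorus.ofTorusSite (FermionTorus.toTorusSite z.1 + Torus.proj L e) = z.2 then ((dWaveFormFactor e / Real.sqrt 2 : ℝ) : ℂ) else 0)) z • bondPair z.1 z.2 - (fun z : FermionTorus 2 L × FermionTorus 2 L => (((dWaveFormFactor ((fun i : Fin 2 => ((ofLex z.2 i : ℕ) : ℤ)) - (fun i : Fin 2 => ((ofLex z.1 i : ℕ) : ℤ))) / Real.sqrt 2 : ℝ) : ℂ))) z • bondPair z.1 z.2 =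
          ((fun z : FermionTorus 2 L × FermionTorus 2 L => ∑ e ∈ insert (0 : Site 2) unitSteps, (if FermionTorus.ofTorusSite (FermionTorus.toTorusSite z.1 + Torus.proj L e) = z.2 then ((dWaveFormFactor e / Real.sqrt 2 : ℝ) : ℂ) else 0)) z - (fun z : FermionTorus 2 L × FermionTorus 2 L => (((dWaveFormFactor ((fun i : Fin 2 => ((ofLex z.2 i : ℕ) : ℤ)) - (fun i : Fin 2 => ((ofLex z.1 i : ℕ) : ℤ))) / Real.sqrt 2 : ℝ) : ℂ))) z) • bondPair z.1 z.2 := fun z => by rw [sub_smul]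
      simp_rw [hsub]
      -- (`have` first: the generic norm bound carries the `LinearOrder`-derived instances, matched by definitional unfolding)
      have hns := twR_norm_sum_smul_le Finset.univ (fun z => (fun z : FermionTorus 2 L × FermionTorus 2 L => ∑ e ∈ insert (0 : Site 2) unitSteps, (if FermionTorus.ofTorusSite (FermionTorus.toTorusSite z.1 + Torus.proj L e) = z.2 then ((dWaveFormFactor e / Real.sqrt 2 : ℝ) : ℂ) else 0)) z - (fun z : FermionTorus 2 L × FermionTorus 2 L => (((dWaveFormFactor ((fun i : Fin 2 => ((ofLex z.2 i : ℕ) : ℤ)) - (fun i : Fin 2 => ((ofLex z.1 i : ℕ) : ℤ))) / Real.sqrt 2 : ℝ) : ℂ))) z) (fun z => bondPair z.1 z.2)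
        (fun z _ => norm_bondPair_le_two _ _)
      refine hns.trans ?_
      have h6 : ∀ z : FermionTorus 2 L × FermionTorus 2 L,
          ‖(fun z : FermionTorus 2 L × FermionTorus 2 L => ∑ e ∈ insert (0 : Site 2) unitSteps, (if FermionTorus.ofTorusSite (FermionTorus.toTorusSite z.1 + Torus.proj L e) = z.2 then ((dWaveFormFactor e / Real.sqrt 2 : ℝ) : ℂ) else 0)) z - (fun z : FermionTorus 2 L × FermionTorus 2 L => (((dWaveFormFactor ((fun i : Fin 2 => ((ofLex z.2 i : ℕ) : ℤ)) - (fun i : Fin 2 => ((ofLex z.1 i : ℕ) : ℤ))) / Real.sqrt 2 : ℝ) : ℂ))) z‖ ≤ 6 := fun z =>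
        (norm_sub_le _ _).trans (by
          have ha := twR_norm_pairWeight_le L z
          have hb : ‖(fun z : FermionTorus 2 L × FermionTorus 2 L => (((dWaveFormFactor ((fun i : Fin 2 => ((ofLex z.2 i : ℕ) : ℤ)) - (fun i : Fin 2 => ((ofLex z.1 i : ℕ) : ℤ))) / Real.sqrt 2 : ℝ) : ℂ))) z‖ ≤ 1 := twR_dWaveKernel_norm_le _
          linarith)
      have hsum := Finset.sum_le_sum fun z (_ : z ∈ (Finset.univ : Finset (FermionTorus 2 L × FermionTorus 2 L))) => h6 z
      rw [Finset.sum_const, Finset.card_univ, Fintype.card_prod, nsmul_eq_mul] at hsum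
      have hcard : ((Fintype.card (FermionTorus 2 L) * Fintype.card (FermionTorus 2 L) : ℕ) : ℝ) ≤ 8 * L := by
        rw [show Fintype.card (FermionTorus 2 L) = L ^ 2 by simp [FermionTorus, Fintype.card_lex]]
        have hL1 := NeZero.pos L
        interval_cases L <;> norm_num
      nlinarith
    have h3 := twR_norm_add_conjTranspose_le (pairField dWaveFormFactor L - (∑ z : FermionTorus 2 L × FermionTorus 2 L, (fun z : FermionTorus 2 L × FermionTorus 2 L => (((dWaveFormFactor ((fun i : Fin 2 => ((ofLex z.2 i : ℕ) : ℤ)) - (fun i : Fin 2 => ((ofLex z.1 i : ℕ) : ℤ))) / Real.sqrt 2 : ℝ) : ℂ))) z • bondPair z.1 z.2))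
    calc ‖(hamiltonianWith (fermionTorusGraph 2 L) 1 U μ - hamiltonianWith ((zdGraph 2).comap (fun x : FermionTorus 2 L => fun i : Fin 2 => ((ofLex x i : ℕ) : ℤ))) 1 U μ) -
          (h : ℂ) • ((pairField dWaveFormFactor L - (∑ z : FermionTorus 2 L × FermionTorus 2 L, (fun z : FermionTorus 2 L × FermionTorus 2 L => (((dWaveFormFactor ((fun i : Fin 2 => ((ofLex z.2 i : ℕ) : ℤ)) - (fun i : Fin 2 => ((ofLex z.1 i : ℕ) : ℤ))) / Real.sqrt 2 : ℝ) : ℂ))) z • bondPair z.1 z.2)) +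
            (pairField dWaveFormFactor L - (∑ z : FermionTorus 2 L × FermionTorus 2 L, (fun z : FermionTorus 2 L × FermionTorus 2 L => (((dWaveFormFactor ((fun i : Fin 2 => ((ofLex z.2 i : ℕ) : ℤ)) - (fun i : Fin 2 => ((ofLex z.1 i : ℕ) : ℤ))) / Real.sqrt 2 : ℝ) : ℂ))) z • bondPair z.1 z.2))ᴴ)‖
        ≤ ‖hamiltonianWith (fermionTorusGraph 2 L) 1 U μ - hamiltonianWith ((zdGraph 2).comap (fun x : FermionTorus 2 L => fun i : Fin 2 => ((ofLex x i : ℕ) : ℤ))) 1 U μ‖ +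
            ‖(h : ℂ) • ((pairField dWaveFormFactor L - (∑ z : FermionTorus 2 L × FermionTorus 2 L, (fun z : FermionTorus 2 L × FermionTorus 2 L => (((dWaveFormFactor ((fun i : Fin 2 => ((ofLex z.2 i : ℕ) : ℤ)) - (fun i : Fin 2 => ((ofLex z.1 i : ℕ) : ℤ))) / Real.sqrt 2 : ℝ) : ℂ))) z • bondPair z.1 z.2)) +
              (pairField dWaveFormFactor L - (∑ z : FermionTorus 2 L × FermionTorus 2 L, (fun z : FermionTorus 2 L × FermionTorus 2 L => (((dWaveFormFactor ((fun i : Fin 2 => ((ofLex z.2 i : ℕ) : ℤ)) - (fun i : Fin 2 => ((ofLex z.1 i : ℕ) : ℤ))) / Real.sqrt 2 : ℝ) : ℂ))) z • bondPair z.1 z.2))ᴴ)‖ := norm_sub_le _ _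
      _ ≤ 8 * L + |h| * (2 * (96 * L)) := by
          rw [norm_smul, Complex.norm_real, Real.norm_eq_abs]
          exact add_le_add h1 (mul_le_mul_of_nonneg_left (h3.trans (by linarith)) (abs_nonneg h))
      _ = (8 + 192 * |h|) * L := by ring

/-- Real scalars are self-adjoint in `ℂ`. [folklore] -/
private theorem bp_isSelfAdjoint_ofReal (x : ℝ) : IsSelfAdjoint (x : ℂ) := by
  rw [isSelfAdjoint_iff, Complex.star_def, Complex.conj_ofReal]

/-! ### The stub -/

set_option maxHeartbeats 400000 in
/-- (registered stub `stub_blockProduct` of skeleton v8; statement verbatim — see Lines/Sketch.lean for the docstring) -/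
theorem stub_blockProduct :
    ∃ C : ℝ, 0 ≤ C ∧ ∀ (L : ℕ) [NeZero L] (M : ℕ), 1 ≤ M → M ≤ L → ∀ (a : ℕ), a ≤ (L / M) ^ 2 →
      ∀ (U μs h : ℝ), 0 ≤ U →
        ∃ (SA SB SR : Finset (Orb (FermionTorus 2 L)))
          (T₀ : Matrix (Finset (Orb (FermionTorus 2 L))) (Finset (Orb (FermionTorus 2 L))) ℂ),
          Disjoint SA SB ∧ Disjoint SA SR ∧ Disjoint SB SR ∧ SA ∪ SB ∪ SR = Finset.univ ∧
          ((SR.card : ℝ) ≤ 6 * L * M) ∧ T₀.IsHermitian ∧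
          ‖(Matrix.diagonal fun s : Finset (Orb (FermionTorus 2 L)) => (((s ∩ SA).card : ℕ) : ℂ)) * (T₀ * (Matrix.diagonal fun s : Finset (Orb (FermionTorus 2 L)) => (((s ∩ SA).card : ℕ) : ℂ)) - (Matrix.diagonal fun s : Finset (Orb (FermionTorus 2 L)) => (((s ∩ SA).card : ℕ) : ℂ)) * T₀) - (T₀ * (Matrix.diagonal fun s : Finset (Orb (FermionTorus 2 L)) => (((s ∩ SA).card : ℕ) : ℂ)) - (Matrix.diagonal fun s : Finset (Orb (FermionTorus 2 L)) => (((s ∩ SA).card : ℕ) : ℂ)) * T₀) * (Matrix.diagonal fun s : Finset (Orb (FermionTorus 2 L)) => (((s ∩ SA).card : ℕ) : ℂ))‖ ≤ C * |h| * (L : ℝ) ^ 2 ∧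
          ‖(Matrix.diagonal fun s : Finset (Orb (FermionTorus 2 L)) => (((s ∩ SB).card : ℕ) : ℂ)) * (T₀ * (Matrix.diagonal fun s : Finset (Orb (FermionTorus 2 L)) => (((s ∩ SB).card : ℕ) : ℂ)) - (Matrix.diagonal fun s : Finset (Orb (FermionTorus 2 L)) => (((s ∩ SB).card : ℕ) : ℂ)) * T₀) - (T₀ * (Matrix.diagonal fun s : Finset (Orb (FermionTorus 2 L)) => (((s ∩ SB).card : ℕ) : ℂ)) - (Matrix.diagonal fun s : Finset (Orb (FermionTorus 2 L)) => (((s ∩ SB).card : ℕ) : ℂ)) * T₀) * (Matrix.diagonal fun s : Finset (Orb (FermionTorus 2 L)) => (((s ∩ SB).card : ℕ) : ℂ))‖ ≤ C * |h| * (L : ℝ) ^ 2 ∧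
          (∀ (β : ℝ), 0 < β → ∃ R : ℝ, |R| ≤ C * (1 + β * (U + |μs|)) * L * M ∧ ∀ (μA μB : ℝ),
            Real.log (Matrix.partitionFn β (T₀ - (μA : ℂ) • (Matrix.diagonal fun s : Finset (Orb (FermionTorus 2 L)) => (((s ∩ SA).card : ℕ) : ℂ)) - (μB : ℂ) • (Matrix.diagonal fun s : Finset (Orb (FermionTorus 2 L)) => (((s ∩ SB).card : ℕ) : ℂ)) - (μs : ℂ) • (Matrix.diagonal fun s : Finset (Orb (FermionTorus 2 L)) => (((s ∩ SR).card : ℕ) : ℂ)))).re =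
              (a : ℝ) * Real.log (Matrix.partitionFn β (hamiltonianWith ((zdGraph 2).comap (fun p : (Lex (Fin M × Fin M)) => ![((ofLex p).1 : ℤ), ((ofLex p).2 : ℤ)])) 1 U μA - (h : ℂ) • ((∑ z : (Lex (Fin M × Fin M)) × (Lex (Fin M × Fin M)), (fun z : (Lex (Fin M × Fin M)) × (Lex (Fin M × Fin M)) => (fun v : Fin 2 → ℤ => ((dWaveFormFactor v / Real.sqrt 2 : ℝ) : ℂ)) (![((ofLex z.2).1 : ℤ), ((ofLex z.2).2 : ℤ)] - ![((ofLex z.1).1 : ℤ), ((ofLex z.1).2 : ℤ)])) z • bondPair z.1 z.2) + (∑ z : (Lex (Fin M × Fin M)) × (Lex (Fin M × Fin M)), (fun z : (Lex (Fin M × Fin M)) × (Lex (Fin M × Fin M)) => (fun v : Fin 2 → ℤ => ((dWaveFormFactor v / Real.sqrt 2 : ℝ) : ℂ)) (![((ofLex z.2).1 : ℤ), ((ofLex z.2).2 : ℤ)] - ![((ofLex z.1).1 : ℤ), ((ofLex z.1).2 : ℤ)])) z • bondPair z.1 z.2)ᴴ))).re +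
                (((L / M) ^ 2 - a : ℕ) : ℝ) * Real.log (Matrix.partitionFn β (hamiltonianWith ((zdGraph 2).comap (fun p : (Lex (Fin M × Fin M)) => ![((ofLex p).1 : ℤ), ((ofLex p).2 : ℤ)])) 1 U μB - (h : ℂ) • ((∑ z : (Lex (Fin M × Fin M)) × (Lex (Fin M × Fin M)), (fun z : (Lex (Fin M × Fin M)) × (Lex (Fin M × Fin M)) => (fun v : Fin 2 → ℤ => ((dWaveFormFactor v / Real.sqrt 2 : ℝ) : ℂ)) (![((ofLex z.2).1 : ℤ), ((ofLex z.2).2 : ℤ)] - ![((ofLex z.1).1 : ℤ), ((ofLex z.1).2 : ℤ)])) z • bondPair z.1 z.2) + (∑ z : (Lex (Fin M × Fin M)) × (Lex (Fin M × Fin M)), (fun z : (Lex (Fin M × Fin M)) × (Lex (Fin M × Fin M)) => (fun v : Fin 2 → ℤ => ((dWaveFormFactor v / Real.sqrt 2 : ℝ) : ℂ)) (![((ofLex z.2).1 : ℤ), ((ofLex z.2).2 : ℤ)] - ![((ofLex z.1).1 : ℤ), ((ofLex z.1).2 : ℤ)])) z • bondPair z.1 z.2)ᴴ))).re + R) ∧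
          (∀ (β : ℝ), 0 < β → ∀ (g : ℝ), 0 < g → ∀ (μA μB : ℝ),
            (Matrix.gibbsState β (T₀ - (μA : ℂ) • (Matrix.diagonal fun s : Finset (Orb (FermionTorus 2 L)) => (((s ∩ SA).card : ℕ) : ℂ)) - (μB : ℂ) • (Matrix.diagonal fun s : Finset (Orb (FermionTorus 2 L)) => (((s ∩ SB).card : ℕ) : ℂ)) - (μs : ℂ) • (Matrix.diagonal fun s : Finset (Orb (FermionTorus 2 L)) => (((s ∩ SR).card : ℕ) : ℂ)))
                ((hubbardTorusWith 2 L 1 U μs - ((g / (L : ℝ) ^ 2 : ℝ) : ℂ) • ((pairField dWaveFormFactor L)ᴴ * pairField dWaveFormFactor L)) - (T₀ - (μA : ℂ) • (Matrix.diagonal fun s : Finset (Orb (FermionTorus 2 L)) => (((s ∩ SA).card : ℕ) : ℂ)) - (μB : ℂ) • (Matrix.diagonal fun s : Finset (Orb (FermionTorus 2 L)) => (((s ∩ SB).card : ℕ) : ℂ)) - (μs : ℂ) • (Matrix.diagonal fun s : Finset (Orb (FermionTorus 2 L)) => (((s ∩ SR).card : ℕ) : ℂ))))).re ≤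
              h ^ 2 / g * (L : ℝ) ^ 2 + (μA - μs) * (Matrix.gibbsState β (T₀ - (μA : ℂ) • (Matrix.diagonal fun s : Finset (Orb (FermionTorus 2 L)) => (((s ∩ SA).card : ℕ) : ℂ)) - (μB : ℂ) • (Matrix.diagonal fun s : Finset (Orb (FermionTorus 2 L)) => (((s ∩ SB).card : ℕ) : ℂ)) - (μs : ℂ) • (Matrix.diagonal fun s : Finset (Orb (FermionTorus 2 L)) => (((s ∩ SR).card : ℕ) : ℂ))) (Matrix.diagonal fun s : Finset (Orb (FermionTorus 2 L)) => (((s ∩ SA).card : ℕ) : ℂ))).re +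
                (μB - μs) * (Matrix.gibbsState β (T₀ - (μA : ℂ) • (Matrix.diagonal fun s : Finset (Orb (FermionTorus 2 L)) => (((s ∩ SA).card : ℕ) : ℂ)) - (μB : ℂ) • (Matrix.diagonal fun s : Finset (Orb (FermionTorus 2 L)) => (((s ∩ SB).card : ℕ) : ℂ)) - (μs : ℂ) • (Matrix.diagonal fun s : Finset (Orb (FermionTorus 2 L)) => (((s ∩ SR).card : ℕ) : ℂ))) (Matrix.diagonal fun s : Finset (Orb (FermionTorus 2 L)) => (((s ∩ SB).card : ℕ) : ℂ))).re +
                C * (1 + |h|) * ((L : ℝ) ^ 2 / M + L * M)) := by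
  refine ⟨256, by norm_num, ?_⟩
  intro L _ M hM hML a ha U μs h hU
  -- ### geometry: `K = ⌊L/M⌋` blocks per row, block embeddings `f c`, thin remainder
  have hM0 : 0 < M := hM
  have hM1 : (1 : ℝ) ≤ M := by exact_mod_cast hM
  have hMr0 : (0 : ℝ) ≤ M := zero_le_one.trans hM1
  have hL0 : (0 : ℝ) ≤ L := Nat.cast_nonneg L
  have hLM0 : (0 : ℝ) ≤ L * M := mul_nonneg hL0 hMr0
  have hLpos : (0 : ℝ) < L := by exact_mod_cast NeZero.pos L
  obtain ⟨f, hf⟩ := Literature.MathematicalPhysics.QuantumLattice.FermionTorus.exists_blockFamily L M hML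
  set blocks : Finset (ℕ × ℕ) := Finset.range (L / M) ×ˢ Finset.range (L / M) with hblocks
  have hdisj : ∀ c ∈ blocks, ∀ c' ∈ blocks, c ≠ c' → ∀ X Y, f c X ≠ f c' Y :=
    Literature.MathematicalPhysics.QuantumLattice.FermionTorus.blockFamily_ne hM0 hf
  have hcardB : blocks.card = (L / M) ^ 2 := Literature.MathematicalPhysics.QuantumLattice.FermionTorus.card_blocks _
  obtain ⟨TA, hTA, hTAcard⟩ := Finset.exists_subset_card_eq (s := blocks) (n := a) (by rw [hcardB]; exact ha)
  set TB : Finset (ℕ × ℕ) := blocks \ TA with hTB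
  have hTBcard : TB.card = (L / M) ^ 2 - a := by rw [hTB, Finset.card_sdiff_of_subset hTA, hcardB, hTAcard]
  have hAB : TA ∪ TB = blocks := Finset.union_sdiff_of_subset hTA
  have hABd : Disjoint TA TB := Finset.disjoint_sdiff
  have hTB' : TB ⊆ blocks := Finset.sdiff_subset
  have hnotA : ∀ c ∈ TB, c ∉ TA := fun c hc => (Finset.mem_sdiff.1 hc).2
  -- pairwise disjoint ranges and orbital ranges; adjacency and weight compatibility
  have hdR : ∀ c ∈ blocks, ∀ c' ∈ blocks, c ≠ c' → Disjoint ((Finset.univ : Finset (FermionTorus 2 M)).map (f c).toEmbedding) ((Finset.univ : Finset (FermionTorus 2 M)).map (f c').toEmbedding) :=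
    disjoint_map_of_ne_range blocks f hdisj fun _ => Finset.univ
  have hdO : ∀ T ⊆ blocks, ∀ c ∈ T, ∀ c' ∈ T, c ≠ c' → Disjoint (orbs ((Finset.univ : Finset (FermionTorus 2 M)).map (f c).toEmbedding)) (orbs ((Finset.univ : Finset (FermionTorus 2 M)).map (f c').toEmbedding)) :=
    fun T hT c hc c' hc' hne => disjoint_orbs (hdR c (hT hc) c' (hT hc') hne)
  have hG : ∀ c ∈ blocks, ∀ X Y, ((zdGraph 2).comap (fun x : FermionTorus 2 M => fun i : Fin 2 => ((ofLex x i : ℕ) : ℤ))).Adj X Y ↔ ((zdGraph 2).comap (fun x : FermionTorus 2 L => fun i : Fin 2 => ((ofLex x i : ℕ) : ℤ))).Adj (f c X) (f c Y) := fun c hc X Y =>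
    Literature.MathematicalPhysics.QuantumLattice.FermionTorus.blockFamily_adj_iff (hf c hc) X Y
  have hw : ∀ c ∈ blocks, ∀ z, (fun z : FermionTorus 2 M × FermionTorus 2 M => (((dWaveFormFactor ((fun i : Fin 2 => ((ofLex z.2 i : ℕ) : ℤ)) - (fun i : Fin 2 => ((ofLex z.1 i : ℕ) : ℤ))) / Real.sqrt 2 : ℝ) : ℂ))) z = (fun z : FermionTorus 2 L × FermionTorus 2 L => (((dWaveFormFactor ((fun i : Fin 2 => ((ofLex z.2 i : ℕ) : ℤ)) - (fun i : Fin 2 => ((ofLex z.1 i : ℕ) : ℤ))) / Real.sqrt 2 : ℝ) : ℂ))) (Prod.map (f c) (f c) z) := fun c hc z =>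
    Literature.MathematicalPhysics.QuantumLattice.FermionTorus.blockFamily_weight_eq (hf c hc)
      (fun v : Fin 2 → ℤ => ((dWaveFormFactor v / Real.sqrt 2 : ℝ) : ℂ)) z
  -- the regional numbers of unions of blocks are sums of block numbers
  have hNsum : ∀ T ⊆ blocks, (Matrix.diagonal fun s : Finset (Orb (FermionTorus 2 L)) => (((s ∩ (orbs (T.biUnion fun c => ((Finset.univ : Finset (FermionTorus 2 M)).map (f c).toEmbedding)))).card : ℕ) : ℂ)) = ∑ c ∈ T, (Matrix.diagonal fun s : Finset (Orb (FermionTorus 2 L)) => (((s ∩ (orbs ((Finset.univ : Finset (FermionTorus 2 M)).map (f c).toEmbedding))).card : ℕ) : ℂ)) := by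
    intro T hT
    rw [orbs_biUnion]
    exact numberDiag_biUnion T _ (hdO T hT)
  -- the block weights: `Σ_z ‖w_M z‖ ≤ 4M²`
  have hW : ∑ z : FermionTorus 2 M × FermionTorus 2 M, ‖(fun z : FermionTorus 2 M × FermionTorus 2 M => (((dWaveFormFactor ((fun i : Fin 2 => ((ofLex z.2 i : ℕ) : ℤ)) - (fun i : Fin 2 => ((ofLex z.1 i : ℕ) : ℤ))) / Real.sqrt 2 : ℝ) : ℂ))) z‖ ≤ 4 * (M : ℝ) ^ 2 := by
    refine (sum_norm_weight_le_card ((zdGraph 2).comap (fun x : FermionTorus 2 M => fun i : Fin 2 => ((ofLex x i : ℕ) : ℤ))) (fun z : FermionTorus 2 M × FermionTorus 2 M => (((dWaveFormFactor ((fun i : Fin 2 => ((ofLex z.2 i : ℕ) : ℤ)) - (fun i : Fin 2 => ((ofLex z.1 i : ℕ) : ℤ))) / Real.sqrt 2 : ℝ) : ℂ))) (bp_boxWeight_le M)).trans ?_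
    exact_mod_cast Literature.MathematicalPhysics.QuantumLattice.FermionTorus.card_boxAdj_pairs_le M
  have hW0 : 0 ≤ ∑ z : FermionTorus 2 M × FermionTorus 2 M, ‖(fun z : FermionTorus 2 M × FermionTorus 2 M => (((dWaveFormFactor ((fun i : Fin 2 => ((ofLex z.2 i : ℕ) : ℤ)) - (fun i : Fin 2 => ((ofLex z.1 i : ℕ) : ℤ))) / Real.sqrt 2 : ℝ) : ℂ))) z‖ := Finset.sum_nonneg fun z _ => norm_nonneg _
  have hKM : ((L / M : ℕ) : ℝ) * M ≤ L := by exact_mod_cast Nat.div_mul_le_self L M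
  have hTBle : (((L / M) ^ 2 - a : ℕ) : ℝ) ≤ ((L / M : ℕ) : ℝ) ^ 2 := by
    have : (L / M) ^ 2 - a ≤ (L / M) ^ 2 := Nat.sub_le _ _
    exact_mod_cast this
  have ha' : (a : ℝ) ≤ ((L / M : ℕ) : ℝ) ^ 2 := by exact_mod_cast ha
  -- Hermiticity of the trial operator
  have hT0 : ((∑ c ∈ blocks, jwEmbed (orbEmb (f c)) (hamiltonianWith ((zdGraph 2).comap (fun x : FermionTorus 2 M => fun i : Fin 2 => ((ofLex x i : ℕ) : ℤ))) 1 U 0 - (h : ℂ) • ((∑ z : FermionTorus 2 M × FermionTorus 2 M, (fun z : FermionTorus 2 M × FermionTorus 2 M => (((dWaveFormFactor ((fun i : Fin 2 => ((ofLex z.2 i : ℕ) : ℤ)) - (fun i : Fin 2 => ((ofLex z.1 i : ℕ) : ℤ))) / Real.sqrt 2 : ℝ) : ℂ))) z • bondPair z.1 z.2) + (∑ z : FermionTorus 2 M × FermionTorus 2 M, (fun z : FermionTorus 2 M × FermionTorus 2 M => (((dWaveFormFactor ((fun i : Fin 2 => ((ofLex z.2 i : ℕ) : ℤ)) - (fun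 i : Fin 2 => ((ofLex z.1 i : ℕ) : ℤ))) / Real.sqrt 2 : ℝ) : ℂ))) z • bondPair z.1 z.2)ᴴ))) + onSiteSum (U : ℂ) 0 ((blocks.biUnion fun c => ((Finset.univ : Finset (FermionTorus 2 M)).map (f c).toEmbedding))ᶜ)).IsHermitian := by
    have hT := isHermitian_blockSum blocks f ((zdGraph 2).comap (fun x : FermionTorus 2 M => fun i : Fin 2 => ((ofLex x i : ℕ) : ℤ))) 1 U 0 0 h (fun z : FermionTorus 2 M × FermionTorus 2 M => (((dWaveFormFactor ((fun i : Fin 2 => ((ofLex z.2 i : ℕ) : ℤ)) - (fun i : Fin 2 => ((ofLex z.1 i : ℕ) : ℤ))) / Real.sqrt 2 : ℝ) : ℂ))) ((blocks.biUnion fun c => ((Finset.univ : Finset (FermionTorus 2 M)).map (f c).toEmbedding))ᶜ)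
    rwa [Complex.ofReal_zero] at hT
  -- ### the witnesses
  refine ⟨(orbs (TA.biUnion fun c => ((Finset.univ : Finset (FermionTorus 2 M)).map (f c).toEmbedding))), (orbs (TB.biUnion fun c => ((Finset.univ : Finset (FermionTorus 2 M)).map (f c).toEmbedding))), orbs ((blocks.biUnion fun c => ((Finset.univ : Finset (FermionTorus 2 M)).map (f c).toEmbedding))ᶜ), ((∑ c ∈ blocks, jwEmbed (orbEmb (f c)) (hamiltonianWith ((zdGraph 2).comap (fun x : FermionTorus 2 M => fun i : Fin 2 => ((ofLex x i : ℕ) : ℤ))) 1 U 0 - (h : ℂ) • ((∑ z : FermionTorus 2 M × FermionTorus 2 M, (fun z : FermionTorus 2 M × FermionTorus 2 M => (((dWaveFormFactor ((fun i : Fin 2 => ((ofLex z.2 i : ℕ) : ℤ)) - (fun i : Fin 2 => ((ofLex z.1 i : ℕ) : ℤ))) / Real.sqrt 2 : ℝ) : ℂ))) z • bondPair z.1 z.2) + (∑ z : FermionTorus 2 M × FermionTorus 2 M, (fun z : FermionTorus 2 M × FermionTorus 2 M => (((dWaveFormFactor ((fun i : Fin 2 => ((ofLex z.2 i : ℕ)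 : ℤ)) - (fun i : Fin 2 => ((ofLex z.1 i : ℕ) : ℤ))) / Real.sqrt 2 : ℝ) : ℂ))) z • bondPair z.1 z.2)ᴴ))) + onSiteSum (U : ℂ) 0 ((blocks.biUnion fun c => ((Finset.univ : Finset (FermionTorus 2 M)).map (f c).toEmbedding))ᶜ)), ?_, ?_, ?_, ?_, ?_, hT0, ?_, ?_, ?_, ?_⟩
  -- (1)–(3) disjointness
  · refine disjoint_orbs ((Finset.disjoint_biUnion_left _ _ _).2 fun c hc => (Finset.disjoint_biUnion_right _ _ _).2 fun c' hc' => ?_)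
    exact hdR c (hTA hc) c' (hTB' hc') (fun h => hnotA c' hc' (h ▸ hc))
  · rw [orbs_compl]
    exact disjoint_compl_right.mono_left (orbs_mono (Finset.biUnion_subset_biUnion_of_subset_left _ hTA))
  · rw [orbs_compl]
    exact disjoint_compl_right.mono_left (orbs_mono (Finset.biUnion_subset_biUnion_of_subset_left _ hTB'))
  -- (4) cover
  · rw [← orbs_union, ← orbs_union, ← Finset.union_biUnion, hAB, Finset.union_compl, orbs_univ]
  -- (5) the remainder is thin
  · rw [card_orbs]
    have h' : ((((blocks.biUnion fun c => ((Finset.univ : Finset (FermionTorus 2 M)).map (f c).toEmbedding))ᶜ).card : ℕ) : ℝ) ≤ ((2 * L * M : ℕ) : ℝ) := by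
      exact_mod_cast Literature.MathematicalPhysics.QuantumLattice.FermionTorus.card_compl_biUnion_blockFamily_le hM0 hf
    push_cast at h' ⊢
    nlinarith [h', hLM0]
  -- (7), (8) the double commutators: only the sources of the graded blocks survive
  · refine (norm_doubleComm_blockSum_le blocks TA hTA f hdisj ((zdGraph 2).comap (fun x : FermionTorus 2 M => fun i : Fin 2 => ((ofLex x i : ℕ) : ℤ))) 1 U h (fun z : FermionTorus 2 M × FermionTorus 2 M => (((dWaveFormFactor ((fun i : Fin 2 => ((ofLex z.2 i : ℕ) : ℤ)) - (fun i : Fin 2 => ((ofLex z.1 i : ℕ) : ℤ))) / Real.sqrt 2 : ℝ) : ℂ))) ((blocks.biUnion fun c => ((Finset.univ : Finset (FermionTorus 2 M)).map (f c).toEmbedding))ᶜ)).trans ?_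
    rw [hTAcard]
    have h1 : (a : ℝ) * (M : ℝ) ^ 2 ≤ (L : ℝ) ^ 2 := by
      have hA := mul_le_mul_of_nonneg_right ha' (sq_nonneg (M : ℝ))
      have hB : (((L / M : ℕ) : ℝ) * M) ^ 2 ≤ (L : ℝ) ^ 2 := pow_le_pow_left₀ (mul_nonneg (Nat.cast_nonneg _) hMr0) hKM 2
      nlinarith [hA, hB]
    calc (a : ℝ) * (16 * |h| * ∑ z : FermionTorus 2 M × FermionTorus 2 M, ‖(fun z : FermionTorus 2 M × FermionTorus 2 M => (((dWaveFormFactor ((fun i : Fin 2 => ((ofLex z.2 i : ℕ) : ℤ)) - (fun i : Fin 2 => ((ofLex z.1 i : ℕ) : ℤ))) / Real.sqrt 2 : ℝ) : ℂ))) z‖)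
        ≤ (a : ℝ) * (16 * |h| * (4 * (M : ℝ) ^ 2)) := by gcongr
      _ = 64 * |h| * ((a : ℝ) * (M : ℝ) ^ 2) := by ring
      _ ≤ 64 * |h| * (L : ℝ) ^ 2 := by gcongr
      _ ≤ 256 * |h| * (L : ℝ) ^ 2 := by nlinarith [abs_nonneg h, sq_nonneg (L : ℝ)]
  · refine (norm_doubleComm_blockSum_le blocks TB hTB' f hdisj ((zdGraph 2).comap (fun x : FermionTorus 2 M => fun i : Fin 2 => ((ofLex x i : ℕ) : ℤ))) 1 U h (fun z : FermionTorus 2 M × FermionTorus 2 M => (((dWaveFormFactor ((fun i : Fin 2 => ((ofLex z.2 i : ℕ) : ℤ)) - (fun i : Fin 2 => ((ofLex z.1 i : ℕ) : ℤ))) / Real.sqrt 2 : ℝ) : ℂ))) ((blocks.biUnion fun c => ((Finset.univ : Finset (FermionTorus 2 M)).map (f c).toEmbedding))ᶜ)).trans ?_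
    rw [hTBcard]
    have h1 : (((L / M) ^ 2 - a : ℕ) : ℝ) * (M : ℝ) ^ 2 ≤ (L : ℝ) ^ 2 := by
      have hA := mul_le_mul_of_nonneg_right hTBle (sq_nonneg (M : ℝ))
      have hB : (((L / M : ℕ) : ℝ) * M) ^ 2 ≤ (L : ℝ) ^ 2 := pow_le_pow_left₀ (mul_nonneg (Nat.cast_nonneg _) hMr0) hKM 2
      nlinarith [hA, hB]
    calc (((L / M) ^ 2 - a : ℕ) : ℝ) * (16 * |h| * ∑ z : FermionTorus 2 M × FermionTorus 2 M, ‖(fun z : FermionTorus 2 M × FermionTorus 2 M => (((dWaveFormFactor ((fun i : Fin 2 => ((ofLex z.2 i : ℕ) : ℤ)) - (fun i : Fin 2 => ((ofLex z.1 i : ℕ) : ℤ))) / Real.sqrt 2 : ℝ) : ℂ))) z‖)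
        ≤ (((L / M) ^ 2 - a : ℕ) : ℝ) * (16 * |h| * (4 * (M : ℝ) ^ 2)) := by gcongr
      _ = 64 * |h| * ((((L / M) ^ 2 - a : ℕ) : ℝ) * (M : ℝ) ^ 2) := by ring
      _ ≤ 64 * |h| * (L : ℝ) ^ 2 := by gcongr
      _ ≤ 256 * |h| * (L : ℝ) ^ 2 := by nlinarith [abs_nonneg h, sq_nonneg (L : ℝ)]
  -- (9) exact separability of the block partition function
  · intro β hβ
    refine ⟨(((blocks.biUnion fun c => ((Finset.univ : Finset (FermionTorus 2 M)).map (f c).toEmbedding))ᶜ).card : ℝ) * Real.log (atomicPartitionFnReal β U μs), ?_, fun μA μB => ?_⟩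
    · obtain ⟨hz0, hz1⟩ := log_atomicPartitionFnReal_bounds hβ.le hU μs
      have hRR2 : ((((blocks.biUnion fun c => ((Finset.univ : Finset (FermionTorus 2 M)).map (f c).toEmbedding))ᶜ).card : ℕ) : ℝ) ≤ ((2 * L * M : ℕ) : ℝ) := by
        exact_mod_cast Literature.MathematicalPhysics.QuantumLattice.FermionTorus.card_compl_biUnion_blockFamily_le hM0 hf
      push_cast at hRR2
      rw [abs_of_nonneg (mul_nonneg (Nat.cast_nonneg _) hz0)]
      have hpos : 0 ≤ 1 + β * (U + |μs|) := by
        have : 0 ≤ β * (U + |μs|) := mul_nonneg hβ.le (by positivity)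
        linarith
      calc (((blocks.biUnion fun c => ((Finset.univ : Finset (FermionTorus 2 M)).map (f c).toEmbedding))ᶜ).card : ℝ) * Real.log (atomicPartitionFnReal β U μs)
          ≤ (2 * L * M) * (2 * (1 + β * (U + |μs|))) := mul_le_mul hRR2 hz1 hz0 (by positivity)
        _ ≤ 256 * (1 + β * (U + |μs|)) * L * M := by nlinarith only [hLM0, hpos]
    · -- chemical potentials per block: `μA` on `TA`, `μB` on `TB`
      have hsplitN : ∑ c ∈ blocks, (((fun c => if c ∈ TA then μA else μB) c : ℝ) : ℂ) • (Matrix.diagonal fun s : Finset (Orb (FermionTorus 2 L)) => (((s ∩ (orbs ((Finset.univ : Finset (FermionTorus 2 M)).map (f c).toEmbedding))).card : ℕ) : ℂ)) =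
          (μA : ℂ) • (Matrix.diagonal fun s : Finset (Orb (FermionTorus 2 L)) => (((s ∩ ((orbs (TA.biUnion fun c => ((Finset.univ : Finset (FermionTorus 2 M)).map (f c).toEmbedding))))).card : ℕ) : ℂ)) + (μB : ℂ) • (Matrix.diagonal fun s : Finset (Orb (FermionTorus 2 L)) => (((s ∩ ((orbs (TB.biUnion fun c => ((Finset.univ : Finset (FermionTorus 2 M)).map (f c).toEmbedding))))).card : ℕ) : ℂ)) := by
        rw [hNsum TA hTA, hNsum TB hTB', ← hAB, Finset.sum_union hABd, Finset.smul_sum, Finset.smul_sum]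
        congr 1
        · exact Finset.sum_congr rfl fun c hc => by simp only [if_pos hc]
        · exact Finset.sum_congr rfl fun c hc => by simp only [if_neg (hnotA c hc)]
      have hKT : (((∑ c ∈ blocks, jwEmbed (orbEmb (f c)) (hamiltonianWith ((zdGraph 2).comap (fun x : FermionTorus 2 M => fun i : Fin 2 => ((ofLex x i : ℕ) : ℤ))) 1 U 0 - (h : ℂ) • ((∑ z : FermionTorus 2 M × FermionTorus 2 M, (fun z : FermionTorus 2 M × FermionTorus 2 M => (((dWaveFormFactor ((fun i : Fin 2 => ((ofLex z.2 i : ℕ) : ℤ)) - (fun i : Fin 2 => ((ofLex z.1 i : ℕ) : ℤ))) / Real.sqrt 2 : ℝ) : ℂ))) z • bondPair z.1 z.2) + (∑ z : FermionTorus 2 M × FermionTorus 2 M, (fun z : FermionTorus 2 M × FermionTorus 2 M => (((dWaveFormFactor ((fun i : Fin 2 => ((ofLex z.2 i : ℕ) : ℤ)) - (fun i : Fin 2 => ((ofLex z.1 i : ℕ) : ℤ))) / Real.sqrt 2 : ℝ) : ℂ))) z • bondPair z.1 z.2)ᴴ))) + onSiteSum (U : ℂ) 0 ((blocks.biUnion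 fun c => ((Finset.univ : Finset (FermionTorus 2 M)).map (f c).toEmbedding))ᶜ)) - (μA : ℂ) • (Matrix.diagonal fun s : Finset (Orb (FermionTorus 2 L)) => (((s ∩ ((orbs (TA.biUnion fun c => ((Finset.univ : Finset (FermionTorus 2 M)).map (f c).toEmbedding))))).card : ℕ) : ℂ)) - (μB : ℂ) • (Matrix.diagonal fun s : Finset (Orb (FermionTorus 2 L)) => (((s ∩ ((orbs (TB.biUnion fun c => ((Finset.univ : Finset (FermionTorus 2 M)).map (f c).toEmbedding))))).card : ℕ) : ℂ)) - (μs : ℂ) • (Matrix.diagonal fun s : Finset (Orb (FermionTorus 2 L)) => (((s ∩ (orbs ((blocks.biUnion fun c => ((Finset.univ : Finset (FermionTorus 2 M)).map (f c).toEmbedding))ᶜ))).card : ℕ) : ℂ))) = (∑ c ∈ blocks, jwEmbed (orbEmb (f c)) (hamiltonianWith ((zdGraph 2).comap (fun x : FermionTorus 2 M => fun i : Fin 2 => ((ofLex x i : ℕ) : ℤ))) 1 U ((fun c => if c ∈ TA then μA else μB) c) - (h : ℂ) • ((∑ z : FermionTorus 2 M × FermionTorus 2 M, (fun z : FermionTorus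 2 M × FermionTorus 2 M => (((dWaveFormFactor ((fun i : Fin 2 => ((ofLex z.2 i : ℕ) : ℤ)) - (fun i : Fin 2 => ((ofLex z.1 i : ℕ) : ℤ))) / Real.sqrt 2 : ℝ) : ℂ))) z • bondPair z.1 z.2) + (∑ z : FermionTorus 2 M × FermionTorus 2 M, (fun z : FermionTorus 2 M × FermionTorus 2 M => (((dWaveFormFactor ((fun i : Fin 2 => ((ofLex z.2 i : ℕ) : ℤ)) - (fun i : Fin 2 => ((ofLex z.1 i : ℕ) : ℤ))) / Real.sqrt 2 : ℝ) : ℂ))) z • bondPair z.1 z.2)ᴴ))) +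
          onSiteSum (U : ℂ) (μs : ℂ) ((blocks.biUnion fun c => ((Finset.univ : Finset (FermionTorus 2 M)).map (f c).toEmbedding))ᶜ) := by
        rw [← sum_jwEmbed_sourced_shift blocks f ((zdGraph 2).comap (fun x : FermionTorus 2 M => fun i : Fin 2 => ((ofLex x i : ℕ) : ℤ))) 1 U h (fun z : FermionTorus 2 M × FermionTorus 2 M => (((dWaveFormFactor ((fun i : Fin 2 => ((ofLex z.2 i : ℕ) : ℤ)) - (fun i : Fin 2 => ((ofLex z.1 i : ℕ) : ℤ))) / Real.sqrt 2 : ℝ) : ℂ))) (fun c => if c ∈ TA then μA else μB) μs ((blocks.biUnion fun c => ((Finset.univ : Finset (FermionTorus 2 M)).map (f c).toEmbedding))ᶜ), hsplitN]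
        abel
      rw [hKT, log_partitionFn_blockSum blocks f hdisj ((zdGraph 2).comap (fun x : FermionTorus 2 M => fun i : Fin 2 => ((ofLex x i : ℕ) : ℤ))) 1 U h (fun z : FermionTorus 2 M × FermionTorus 2 M => (((dWaveFormFactor ((fun i : Fin 2 => ((ofLex z.2 i : ℕ) : ℤ)) - (fun i : Fin 2 => ((ofLex z.1 i : ℕ) : ℤ))) / Real.sqrt 2 : ℝ) : ℂ))) (fun c => if c ∈ TA then μA else μB) μs β]
      have hsum : ∑ c ∈ blocks, Real.log (partitionFn β (hamiltonianWith ((zdGraph 2).comap (fun x : FermionTorus 2 M => fun i : Fin 2 => ((ofLex x i : ℕ) : ℤ))) 1 U ((fun c => if c ∈ TA then μA else μB) c) - (h : ℂ) • ((∑ z : FermionTorus 2 M × FermionTorus 2 M, (fun z : FermionTorus 2 M × FermionTorus 2 M => (((dWaveFormFactor ((fun i : Fin 2 => ((ofLex z.2 i : ℕ) : ℤ)) - (fun i : Fin 2 => ((ofLex z.1 i : ℕ) : ℤ))) / Real.sqrt 2 : ℝ) : ℂ))) z • bondPair z.1 z.2) + (∑ z : FermionTorus 2 M × FermionTorus 2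 M, (fun z : FermionTorus 2 M × FermionTorus 2 M => (((dWaveFormFactor ((fun i : Fin 2 => ((ofLex z.2 i : ℕ) : ℤ)) - (fun i : Fin 2 => ((ofLex z.1 i : ℕ) : ℤ))) / Real.sqrt 2 : ℝ) : ℂ))) z • bondPair z.1 z.2)ᴴ))).re =
          (a : ℝ) * Real.log (partitionFn β (hamiltonianWith ((zdGraph 2).comap (fun x : FermionTorus 2 M => fun i : Fin 2 => ((ofLex x i : ℕ) : ℤ))) 1 U μA - (h : ℂ) • ((∑ z : FermionTorus 2 M × FermionTorus 2 M, (fun z : FermionTorus 2 M × FermionTorus 2 M => (((dWaveFormFactor ((fun i : Fin 2 => ((ofLex z.2 i : ℕ) : ℤ)) - (fun i : Fin 2 => ((ofLex z.1 i : ℕ) : ℤ))) / Real.sqrt 2 : ℝ) : ℂ))) z • bondPair z.1 z.2) + (∑ z : FermionTorus 2 M × FermionTorus 2 M, (fun z : FermionTorus 2 M × FermionTorus 2 M => (((dWaveFormFactor ((fun i : Fin 2 => ((ofLex z.2 i : ℕ) : ℤ)) - (fun i : Fin 2 => ((ofLex z.1 i : ℕ) : ℤ))) / Real.sqrt 2 :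 ℝ) : ℂ))) z • bondPair z.1 z.2)ᴴ))).re + (((L / M) ^ 2 - a : ℕ) : ℝ) * Real.log (partitionFn β (hamiltonianWith ((zdGraph 2).comap (fun x : FermionTorus 2 M => fun i : Fin 2 => ((ofLex x i : ℕ) : ℤ))) 1 U μB - (h : ℂ) • ((∑ z : FermionTorus 2 M × FermionTorus 2 M, (fun z : FermionTorus 2 M × FermionTorus 2 M => (((dWaveFormFactor ((fun i : Fin 2 => ((ofLex z.2 i : ℕ) : ℤ)) - (fun i : Fin 2 => ((ofLex z.1 i : ℕ) : ℤ))) / Real.sqrt 2 : ℝ) : ℂ))) z • bondPair z.1 z.2) + (∑ z : FermionTorus 2 M × FermionTorus 2 M, (fun z : FermionTorus 2 M × FermionTorus 2 M => (((dWaveFormFactor ((fun i : Fin 2 => ((ofLex z.2 i : ℕ) : ℤ)) - (fun i : Fin 2 => ((ofLex z.1 i : ℕ) : ℤ))) / Real.sqrt 2 : ℝ) : ℂ))) z • bondPair z.1 z.2)ᴴ))).re := by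
        rw [← hAB, Finset.sum_union hABd]
        have h1 : ∀ c ∈ TA, Real.log (partitionFn β (hamiltonianWith ((zdGraph 2).comap (fun x : FermionTorus 2 M => fun i : Fin 2 => ((ofLex x i : ℕ) : ℤ))) 1 U ((fun c => if c ∈ TA then μA else μB) c) - (h : ℂ) • ((∑ z : FermionTorus 2 M × FermionTorus 2 M, (fun z : FermionTorus 2 M × FermionTorus 2 M => (((dWaveFormFactor ((fun i : Fin 2 => ((ofLex z.2 i : ℕ) : ℤ)) - (fun i : Fin 2 => ((ofLex z.1 i : ℕ) : ℤ))) / Real.sqrt 2 : ℝ) : ℂ))) z • bondPair z.1 z.2) + (∑ z : FermionTorus 2 M × FermionTorus 2 M, (fun z : FermionTorus 2 M × FermionTorus 2 M => (((dWaveFormFactor ((fun i : Fin 2 => ((ofLex z.2 i : ℕ) : ℤ)) - (fun i : Fin 2 => ((ofLex z.1 i : ℕ) : ℤ))) / Real.sqrt 2 : ℝ) : ℂ))) z • bondPair z.1 z.2)ᴴ))).re =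
            Real.log (partitionFn β (hamiltonianWith ((zdGraph 2).comap (fun x : FermionTorus 2 M => fun i : Fin 2 => ((ofLex x i : ℕ) : ℤ))) 1 U μA - (h : ℂ) • ((∑ z : FermionTorus 2 M × FermionTorus 2 M, (fun z : FermionTorus 2 M × FermionTorus 2 M => (((dWaveFormFactor ((fun i : Fin 2 => ((ofLex z.2 i : ℕ) : ℤ)) - (fun i : Fin 2 => ((ofLex z.1 i : ℕ) : ℤ))) / Real.sqrt 2 : ℝ) : ℂ))) z • bondPair z.1 z.2) + (∑ z : FermionTorus 2 M × FermionTorus 2 M, (fun z : FermionTorus 2 M × FermionTorus 2 M => (((dWaveFormFactor ((fun i : Fin 2 => ((ofLex z.2 i : ℕ) : ℤ)) - (fun i : Fin 2 => ((ofLex z.1 i : ℕ) : ℤ))) / Real.sqrt 2 : ℝ) : ℂ))) z • bondPair z.1 z.2)ᴴ))).re := fun c hc => by simp only [if_pos hc]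
        have h2 : ∀ c ∈ TB, Real.log (partitionFn β (hamiltonianWith ((zdGraph 2).comap (fun x : FermionTorus 2 M => fun i : Fin 2 => ((ofLex x i : ℕ) : ℤ))) 1 U ((fun c => if c ∈ TA then μA else μB) c) - (h : ℂ) • ((∑ z : FermionTorus 2 M × FermionTorus 2 M, (fun z : FermionTorus 2 M × FermionTorus 2 M => (((dWaveFormFactor ((fun i : Fin 2 => ((ofLex z.2 i : ℕ) : ℤ)) - (fun i : Fin 2 => ((ofLex z.1 i : ℕ) : ℤ))) / Real.sqrt 2 : ℝ) : ℂ))) z • bondPair z.1 z.2) + (∑ z : FermionTorus 2 M × FermionTorus 2 M, (fun z : FermionTorus 2 M × FermionTorus 2 M => (((dWaveFormFactor ((fun i : Fin 2 => ((ofLex z.2 i : ℕ) : ℤ)) - (fun i : Fin 2 => ((ofLex z.1 i : ℕ) : ℤ))) / Real.sqrt 2 : ℝ) : ℂ))) z • bondPair z.1 z.2)ᴴ))).re =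
            Real.log (partitionFn β (hamiltonianWith ((zdGraph 2).comap (fun x : FermionTorus 2 M => fun i : Fin 2 => ((ofLex x i : ℕ) : ℤ))) 1 U μB - (h : ℂ) • ((∑ z : FermionTorus 2 M × FermionTorus 2 M, (fun z : FermionTorus 2 M × FermionTorus 2 M => (((dWaveFormFactor ((fun i : Fin 2 => ((ofLex z.2 i : ℕ) : ℤ)) - (fun i : Fin 2 => ((ofLex z.1 i : ℕ) : ℤ))) / Real.sqrt 2 : ℝ) : ℂ))) z • bondPair z.1 z.2) + (∑ z : FermionTorus 2 M × FermionTorus 2 M, (fun z : FermionTorus 2 M × FermionTorus 2 M => (((dWaveFormFactor ((fun i : Fin 2 => ((ofLex z.2 i : ℕ) : ℤ)) - (fun i : Fin 2 => ((ofLex z.1 i : ℕ) : ℤ))) / Real.sqrt 2 : ℝ) : ℂ))) z • bondPair z.1 z.2)ᴴ))).re := fun c hc => by simp only [if_neg (hnotA c hc)]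
        rw [Finset.sum_congr rfl h1, Finset.sum_congr rfl h2, Finset.sum_const, Finset.sum_const, nsmul_eq_mul, nsmul_eq_mul,
          hTAcard, hTBcard]
      have hZA : Real.log (partitionFn β (hamiltonianWith ((zdGraph 2).comap (fun x : FermionTorus 2 M => fun i : Fin 2 => ((ofLex x i : ℕ) : ℤ))) 1 U μA - (h : ℂ) • ((∑ z : FermionTorus 2 M × FermionTorus 2 M, (fun z : FermionTorus 2 M × FermionTorus 2 M => (((dWaveFormFactor ((fun i : Fin 2 => ((ofLex z.2 i : ℕ) : ℤ)) - (fun i : Fin 2 => ((ofLex z.1 i : ℕ) : ℤ))) / Real.sqrt 2 : ℝ) : ℂ))) z • bondPair z.1 z.2) + (∑ z : FermionTorus 2 M × FermionTorus 2 M, (fun z : FermionTorus 2 M × FermionTorus 2 M => (((dWaveFormFactor ((fun i : Fin 2 => ((ofLex z.2 i : ℕ) : ℤ)) - (fun i : Fin 2 => ((ofLex z.1 i : ℕ) : ℤ))) / Real.sqrt 2 : ℝ) : ℂ))) z • bondPair z.1 z.2)ᴴ))).re = Real.log (partitionFn β (hamiltonianWith ((zdGraph 2).comap (fun p : (Lex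 (Fin M × Fin M)) => ![((ofLex p).1 : ℤ), ((ofLex p).2 : ℤ)])) 1 U μA - (h : ℂ) • ((∑ z : (Lex (Fin M × Fin M)) × (Lex (Fin M × Fin M)), (fun z : (Lex (Fin M × Fin M)) × (Lex (Fin M × Fin M)) => (fun v : Fin 2 → ℤ => ((dWaveFormFactor v / Real.sqrt 2 : ℝ) : ℂ)) (![((ofLex z.2).1 : ℤ), ((ofLex z.2).2 : ℤ)] - ![((ofLex z.1).1 : ℤ), ((ofLex z.1).2 : ℤ)])) z • bondPair z.1 z.2) + (∑ z : (Lex (Fin M × Fin M)) × (Lex (Fin M × Fin M)), (fun z : (Lex (Fin M × Fin M)) × (Lex (Fin M × Fin M)) => (fun v : Fin 2 → ℤ => ((dWaveFormFactor v / Real.sqrt 2 : ℝ) : ℂ)) (![((ofLex z.2).1 : ℤ), ((ofLex z.2).2 : ℤ)] - ![((ofLex z.1).1 : ℤ), ((ofLex z.1).2 : ℤ)])) z • bondPair z.1 z.2)ᴴ))).re := by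
        rw [twR_box_partitionFn_eq_rect M β U μA h]
      have hZB : Real.log (partitionFn β (hamiltonianWith ((zdGraph 2).comap (fun x : FermionTorus 2 M => fun i : Fin 2 => ((ofLex x i : ℕ) : ℤ))) 1 U μB - (h : ℂ) • ((∑ z : FermionTorus 2 M × FermionTorus 2 M, (fun z : FermionTorus 2 M × FermionTorus 2 M => (((dWaveFormFactor ((fun i : Fin 2 => ((ofLex z.2 i : ℕ) : ℤ)) - (fun i : Fin 2 => ((ofLex z.1 i : ℕ) : ℤ))) / Real.sqrt 2 : ℝ) : ℂ))) z • bondPair z.1 z.2) + (∑ z : FermionTorus 2 M × FermionTorus 2 M, (fun z : FermionTorus 2 M × FermionTorus 2 M => (((dWaveFormFactor ((fun i : Fin 2 => ((ofLex z.2 i : ℕ) : ℤ)) - (fun i : Fin 2 => ((ofLex z.1 i : ℕ) : ℤ))) / Real.sqrt 2 : ℝ) : ℂ))) z • bondPair z.1 z.2)ᴴ))).re = Real.log (partitionFn β (hamiltonianWith ((zdGraph 2).comap (fun p : (Lex (Fin M × Fin M)) => ![((ofLex p).1 : ℤ), ((ofLex p).2 : ℤ)])) 1 U μB - (h : ℂ)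 • ((∑ z : (Lex (Fin M × Fin M)) × (Lex (Fin M × Fin M)), (fun z : (Lex (Fin M × Fin M)) × (Lex (Fin M × Fin M)) => (fun v : Fin 2 → ℤ => ((dWaveFormFactor v / Real.sqrt 2 : ℝ) : ℂ)) (![((ofLex z.2).1 : ℤ), ((ofLex z.2).2 : ℤ)] - ![((ofLex z.1).1 : ℤ), ((ofLex z.1).2 : ℤ)])) z • bondPair z.1 z.2) + (∑ z : (Lex (Fin M × Fin M)) × (Lex (Fin M × Fin M)), (fun z : (Lex (Fin M × Fin M)) × (Lex (Fin M × Fin M)) => (fun v : Fin 2 → ℤ => ((dWaveFormFactor v / Real.sqrt 2 : ℝ) : ℂ)) (![((ofLex z.2).1 : ℤ), ((ofLex z.2).2 : ℤ)] - ![((ofLex z.1).1 : ℤ), ((ofLex z.1).2 : ℤ)])) z • bondPair z.1 z.2)ᴴ))).re := by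
        rw [twR_box_partitionFn_eq_rect M β U μB h]
      rw [hsum, hZA, hZB]
  -- (10) the comparison inequality in the trial state
  · intro β hβ g hg μA μB
    have hKh : (((∑ c ∈ blocks, jwEmbed (orbEmb (f c)) (hamiltonianWith ((zdGraph 2).comap (fun x : FermionTorus 2 M => fun i : Fin 2 => ((ofLex x i : ℕ) : ℤ))) 1 U 0 - (h : ℂ) • ((∑ z : FermionTorus 2 M × FermionTorus 2 M, (fun z : FermionTorus 2 M × FermionTorus 2 M => (((dWaveFormFactor ((fun i : Fin 2 => ((ofLex z.2 i : ℕ) : ℤ)) - (fun i : Fin 2 => ((ofLex z.1 i : ℕ) : ℤ))) / Real.sqrt 2 : ℝ) : ℂ))) z • bondPair z.1 z.2) + (∑ z : FermionTorus 2 M × FermionTorus 2 M, (fun z : FermionTorus 2 M × FermionTorus 2 M => (((dWaveFormFactor ((fun i : Fin 2 => ((ofLex z.2 i : ℕ) : ℤ)) - (fun i : Fin 2 => ((ofLex z.1 i : ℕ) : ℤ))) / Real.sqrt 2 : ℝ) : ℂ))) z • bondPair z.1 z.2)ᴴ))) + onSiteSum (U : ℂ) 0 ((blocks.biUnion fun c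 => ((Finset.univ : Finset (FermionTorus 2 M)).map (f c).toEmbedding))ᶜ)) - (μA : ℂ) • (Matrix.diagonal fun s : Finset (Orb (FermionTorus 2 L)) => (((s ∩ ((orbs (TA.biUnion fun c => ((Finset.univ : Finset (FermionTorus 2 M)).map (f c).toEmbedding))))).card : ℕ) : ℂ)) - (μB : ℂ) • (Matrix.diagonal fun s : Finset (Orb (FermionTorus 2 L)) => (((s ∩ ((orbs (TB.biUnion fun c => ((Finset.univ : Finset (FermionTorus 2 M)).map (f c).toEmbedding))))).card : ℕ) : ℂ)) - (μs : ℂ) • (Matrix.diagonal fun s : Finset (Orb (FermionTorus 2 L)) => (((s ∩ (orbs ((blocks.biUnion fun c => ((Finset.univ : Finset (FermionTorus 2 M)).map (f c).toEmbedding))ᶜ))).card : ℕ) : ℂ))).IsHermitian :=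
      ((hT0.sub ((isHermitian_numberDiag _).smul (bp_isSelfAdjoint_ofReal μA))).sub
        ((isHermitian_numberDiag _).smul (bp_isSelfAdjoint_ofReal μB))).sub
        ((isHermitian_numberDiag _).smul (bp_isSelfAdjoint_ofReal μs))
    -- all blocks at `μs`: `K̃ + (μA − μs)N_A + (μB − μs)N_B = Σ_c (f_c)_* H_M(μs) + V_RR(μs)`
    have hNall : ∑ c ∈ blocks, (((fun _ : ℕ × ℕ => μs) c : ℝ) : ℂ) • (Matrix.diagonal fun s : Finset (Orb (FermionTorus 2 L)) => (((s ∩ (orbs ((Finset.univ : Finset (FermionTorus 2 M)).map (f c).toEmbedding))).card : ℕ) : ℂ)) = (μs : ℂ) • (Matrix.diagonal fun s : Finset (Orb (FermionTorus 2 L)) => (((s ∩ ((orbs (TA.biUnion fun c => ((Finset.univ : Finset (FermionTorus 2 M)).map (f c).toEmbedding))))).card : ℕ) : ℂ)) + (μs : ℂ) • (Matrix.diagonal fun s : Finset (Orb (FermionTorus 2 L)) => (((s ∩ ((orbs (TB.biUnion fun c => ((Finset.univ : Finset (FermionTorus 2 M)).map (f c).toEmbedding))))).card : ℕ) : ℂ))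 := by
      rw [hNsum TA hTA, hNsum TB hTB', ← smul_add, ← Finset.sum_union hABd, hAB, Finset.smul_sum]
    have hKs : (((∑ c ∈ blocks, jwEmbed (orbEmb (f c)) (hamiltonianWith ((zdGraph 2).comap (fun x : FermionTorus 2 M => fun i : Fin 2 => ((ofLex x i : ℕ) : ℤ))) 1 U 0 - (h : ℂ) • ((∑ z : FermionTorus 2 M × FermionTorus 2 M, (fun z : FermionTorus 2 M × FermionTorus 2 M => (((dWaveFormFactor ((fun i : Fin 2 => ((ofLex z.2 i : ℕ) : ℤ)) - (fun i : Fin 2 => ((ofLex z.1 i : ℕ) : ℤ))) / Real.sqrt 2 : ℝ) : ℂ))) z • bondPair z.1 z.2) + (∑ z : FermionTorus 2 M × FermionTorus 2 M, (fun z : FermionTorus 2 M × FermionTorus 2 M => (((dWaveFormFactor ((fun i : Fin 2 => ((ofLex z.2 i : ℕ) : ℤ)) - (fun i : Fin 2 => ((ofLex z.1 i : ℕ) : ℤ))) / Real.sqrt 2 : ℝ) : ℂ))) z • bondPair z.1 z.2)ᴴ))) + onSiteSum (U : ℂ) 0 ((blocks.biUnion fun c => ((Finset.univ : Finset (FermionTorus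 2 M)).map (f c).toEmbedding))ᶜ)) - (μA : ℂ) • (Matrix.diagonal fun s : Finset (Orb (FermionTorus 2 L)) => (((s ∩ ((orbs (TA.biUnion fun c => ((Finset.univ : Finset (FermionTorus 2 M)).map (f c).toEmbedding))))).card : ℕ) : ℂ)) - (μB : ℂ) • (Matrix.diagonal fun s : Finset (Orb (FermionTorus 2 L)) => (((s ∩ ((orbs (TB.biUnion fun c => ((Finset.univ : Finset (FermionTorus 2 M)).map (f c).toEmbedding))))).card : ℕ) : ℂ)) - (μs : ℂ) • (Matrix.diagonal fun s : Finset (Orb (FermionTorus 2 L)) => (((s ∩ (orbs ((blocks.biUnion fun c => ((Finset.univ : Finset (FermionTorus 2 M)).map (f c).toEmbedding))ᶜ))).card : ℕ) : ℂ))) + ((μA - μs : ℝ) : ℂ) • (Matrix.diagonal fun s : Finset (Orb (FermionTorus 2 L)) => (((s ∩ ((orbs (TA.biUnion fun c => ((Finset.univ : Finset (FermionTorus 2 M)).map (f c).toEmbedding))))).card : ℕ) : ℂ)) + ((μB - μs : ℝ) : ℂ) • (Matrix.diagonal fun s : Finset (Orb (FermionTorus 2 L)) => (((s ∩ ((orbs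 (TB.biUnion fun c => ((Finset.univ : Finset (FermionTorus 2 M)).map (f c).toEmbedding))))).card : ℕ) : ℂ)) = ((∑ c ∈ blocks, jwEmbed (orbEmb (f c)) (hamiltonianWith ((zdGraph 2).comap (fun x : FermionTorus 2 M => fun i : Fin 2 => ((ofLex x i : ℕ) : ℤ))) 1 U μs - (h : ℂ) • ((∑ z : FermionTorus 2 M × FermionTorus 2 M, (fun z : FermionTorus 2 M × FermionTorus 2 M => (((dWaveFormFactor ((fun i : Fin 2 => ((ofLex z.2 i : ℕ) : ℤ)) - (fun i : Fin 2 => ((ofLex z.1 i : ℕ) : ℤ))) / Real.sqrt 2 : ℝ) : ℂ))) z • bondPair z.1 z.2) + (∑ z : FermionTorus 2 M × FermionTorus 2 M, (fun z : FermionTorus 2 M × FermionTorus 2 M => (((dWaveFormFactor ((fun i : Fin 2 => ((ofLex z.2 i : ℕ) : ℤ)) - (fun i : Fin 2 => ((ofLex z.1 i : ℕ) : ℤ))) / Real.sqrt 2 : ℝ) : ℂ))) z • bondPair z.1 z.2)ᴴ))) + onSiteSum (U : ℂ) (μs : ℂ) ((blocks.biUnion fun c => ((Finset.univ : Finset (FermionTorus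 2 M)).map (f c).toEmbedding))ᶜ)) := by
      rw [← sum_jwEmbed_sourced_shift blocks f ((zdGraph 2).comap (fun x : FermionTorus 2 M => fun i : Fin 2 => ((ofLex x i : ℕ) : ℤ))) 1 U h (fun z : FermionTorus 2 M × FermionTorus 2 M => (((dWaveFormFactor ((fun i : Fin 2 => ((ofLex z.2 i : ℕ) : ℤ)) - (fun i : Fin 2 => ((ofLex z.1 i : ℕ) : ℤ))) / Real.sqrt 2 : ℝ) : ℂ))) (fun _ => μs) μs ((blocks.biUnion fun c => ((Finset.univ : Finset (FermionTorus 2 M)).map (f c).toEmbedding))ᶜ), hNall, Complex.ofReal_sub,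
        Complex.ofReal_sub]
      module
    have hdec : (hubbardTorusWith 2 L 1 U μs - ((g / (L : ℝ) ^ 2 : ℝ) : ℂ) • ((pairField dWaveFormFactor L)ᴴ * pairField dWaveFormFactor L)) - (((∑ c ∈ blocks, jwEmbed (orbEmb (f c)) (hamiltonianWith ((zdGraph 2).comap (fun x : FermionTorus 2 M => fun i : Fin 2 => ((ofLex x i : ℕ) : ℤ))) 1 U 0 - (h : ℂ) • ((∑ z : FermionTorus 2 M × FermionTorus 2 M, (fun z : FermionTorus 2 M × FermionTorus 2 M => (((dWaveFormFactor ((fun i : Fin 2 => ((ofLex z.2 i : ℕ) : ℤ)) - (fun i : Fin 2 => ((ofLex z.1 i : ℕ) : ℤ))) / Real.sqrt 2 : ℝ) : ℂ))) z • bondPair z.1 z.2) + (∑ z : FermionTorus 2 M × FermionTorus 2 M, (fun z : FermionTorus 2 M × FermionTorus 2 M => (((dWaveFormFactor ((fun i : Fin 2 => ((ofLex z.2 i : ℕ) : ℤ)) - (fun i : Fin 2 => ((ofLex z.1 i : ℕ) : ℤ))) / Real.sqrt 2 : ℝ) : ℂ))) z • bondPair z.1 z.2)ᴴ))) + onSiteSum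 (U : ℂ) 0 ((blocks.biUnion fun c => ((Finset.univ : Finset (FermionTorus 2 M)).map (f c).toEmbedding))ᶜ)) - (μA : ℂ) • (Matrix.diagonal fun s : Finset (Orb (FermionTorus 2 L)) => (((s ∩ ((orbs (TA.biUnion fun c => ((Finset.univ : Finset (FermionTorus 2 M)).map (f c).toEmbedding))))).card : ℕ) : ℂ)) - (μB : ℂ) • (Matrix.diagonal fun s : Finset (Orb (FermionTorus 2 L)) => (((s ∩ ((orbs (TB.biUnion fun c => ((Finset.univ : Finset (FermionTorus 2 M)).map (f c).toEmbedding))))).card : ℕ) : ℂ)) - (μs : ℂ) • (Matrix.diagonal fun s : Finset (Orb (FermionTorus 2 L)) => (((s ∩ (orbs ((blocks.biUnion fun c => ((Finset.univ : Finset (FermionTorus 2 M)).map (f c).toEmbedding))ᶜ))).card : ℕ) : ℂ))) =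
        (-(((g / (L : ℝ) ^ 2 : ℝ) : ℂ) • ((pairField dWaveFormFactor L)ᴴ * pairField dWaveFormFactor L)) + (h : ℂ) • (pairField dWaveFormFactor L + (pairField dWaveFormFactor L)ᴴ)) + (dWaveSourceTorus L U μs h - ((∑ c ∈ blocks, jwEmbed (orbEmb (f c)) (hamiltonianWith ((zdGraph 2).comap (fun x : FermionTorus 2 M => fun i : Fin 2 => ((ofLex x i : ℕ) : ℤ))) 1 U μs - (h : ℂ) • ((∑ z : FermionTorus 2 M × FermionTorus 2 M, (fun z : FermionTorus 2 M × FermionTorus 2 M => (((dWaveFormFactor ((fun i : Fin 2 => ((ofLex z.2 i : ℕ) : ℤ)) - (fun i : Fin 2 => ((ofLex z.1 i : ℕ) : ℤ))) / Real.sqrt 2 : ℝ) : ℂ))) z • bondPair z.1 z.2) + (∑ z : FermionTorus 2 M × FermionTorus 2 M, (fun z : FermionTorus 2 M × FermionTorus 2 M => (((dWaveFormFactor ((fun i : Fin 2 => ((ofLex z.2 i : ℕ) : ℤ)) - (fun i : Fin 2 => ((ofLex z.1 i : ℕ) : ℤ))) / Real.sqrt 2 : ℝ) : ℂ))) z • bondPair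 z.1 z.2)ᴴ))) + onSiteSum (U : ℂ) (μs : ℂ) ((blocks.biUnion fun c => ((Finset.univ : Finset (FermionTorus 2 M)).map (f c).toEmbedding))ᶜ))) + ((μA - μs : ℝ) : ℂ) • (Matrix.diagonal fun s : Finset (Orb (FermionTorus 2 L)) => (((s ∩ ((orbs (TA.biUnion fun c => ((Finset.univ : Finset (FermionTorus 2 M)).map (f c).toEmbedding))))).card : ℕ) : ℂ)) + ((μB - μs : ℝ) : ℂ) • (Matrix.diagonal fun s : Finset (Orb (FermionTorus 2 L)) => (((s ∩ ((orbs (TB.biUnion fun c => ((Finset.univ : Finset (FermionTorus 2 M)).map (f c).toEmbedding))))).card : ℕ) : ℂ)) := by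
      rw [← hKs, dWaveSourceTorus]
      abel
    -- the boundary operator `W`
    have hE1 := bp_norm_torus_sub_box_le L U μs h
    have hE2 := norm_sourced_sub_sum_jwEmbed_sub_onSiteSum_le_of_card_le blocks f hdisj ((zdGraph 2).comap (fun x : FermionTorus 2 L => fun i : Fin 2 => ((ofLex x i : ℕ) : ℤ))) ((zdGraph 2).comap (fun x : FermionTorus 2 M => fun i : Fin 2 => ((ofLex x i : ℕ) : ℤ))) hG 1 U μs h (fun z : FermionTorus 2 L × FermionTorus 2 L => (((dWaveFormFactor ((fun i : Fin 2 => ((ofLex z.2 i : ℕ) : ℤ)) - (fun i : Fin 2 => ((ofLex z.1 i : ℕ) : ℤ))) / Real.sqrt 2 : ℝ) : ℂ)))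
      (fun z : FermionTorus 2 M × FermionTorus 2 M => (((dWaveFormFactor ((fun i : Fin 2 => ((ofLex z.2 i : ℕ) : ℤ)) - (fun i : Fin 2 => ((ofLex z.1 i : ℕ) : ℤ))) / Real.sqrt 2 : ℝ) : ℂ))) hw (bp_boxWeight_le L) (Literature.MathematicalPhysics.QuantumLattice.FermionTorus.card_boxAdj_not_sameBlock_le hM0 hf)
    have hcast : ((8 * L * (2 * (L / M) + M + 1) : ℕ) : ℝ) = 8 * L * (2 * ((L / M : ℕ) : ℝ) + M + 1) := by push_cast; ring
    rw [abs_one, hcast] at hE2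
    have hX0 : 0 ≤ (L : ℝ) ^ 2 / M := by positivity
    have hLK : (L : ℝ) * ((L / M : ℕ) : ℝ) ≤ (L : ℝ) ^ 2 / M := by
      rw [le_div_iff₀ (by positivity : (0 : ℝ) < M)]
      nlinarith only [hKM, hL0]
    have hLLM : (L : ℝ) ≤ L * M := le_mul_of_one_le_right hL0 hM1
    have hb1 : (8 : ℝ) * L * (2 * ((L / M : ℕ) : ℝ) + M + 1) ≤ 16 * ((L : ℝ) ^ 2 / M + L * M) := by
      have e : (8 : ℝ) * L * (2 * ((L / M : ℕ) : ℝ) + M + 1) = 16 * ((L : ℝ) * ((L / M : ℕ) : ℝ)) + 8 * (L * M) + 8 * L := by ring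
      rw [e]
      linarith only [hLK, hLLM]
    have hb2 : (8 + 192 * |h|) * (L : ℝ) ≤ (8 + 192 * |h|) * ((L : ℝ) ^ 2 / M + L * M) :=
      mul_le_mul_of_nonneg_left (by linarith only [hLLM, hX0]) (by positivity)
    have hb3 : (2 * 1 + 4 * |h|) * (8 * L * (2 * ((L / M : ℕ) : ℝ) + M + 1)) ≤ (2 * 1 + 4 * |h|) * (16 * ((L : ℝ) ^ 2 / M + L * M)) :=
      mul_le_mul_of_nonneg_left hb1 (by positivity)
    have hb4 : (8 + 192 * |h|) * ((L : ℝ) ^ 2 / M + L * M) + (2 * 1 + 4 * |h|) * (16 * ((L : ℝ) ^ 2 / M + L * M)) ≤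
        256 * (1 + |h|) * ((L : ℝ) ^ 2 / M + L * M) := by
      have hY0 : 0 ≤ |h| * ((L : ℝ) ^ 2 / M + L * M) := mul_nonneg (abs_nonneg h) (by positivity)
      nlinarith only [hY0, hX0, hLM0, abs_nonneg h]
    have hWn : ‖dWaveSourceTorus L U μs h - ((∑ c ∈ blocks, jwEmbed (orbEmb (f c)) (hamiltonianWith ((zdGraph 2).comap (fun x : FermionTorus 2 M => fun i : Fin 2 => ((ofLex x i : ℕ) : ℤ))) 1 U μs - (h : ℂ) • ((∑ z : FermionTorus 2 M × FermionTorus 2 M, (fun z : FermionTorus 2 M × FermionTorus 2 M => (((dWaveFormFactor ((fun i : Fin 2 => ((ofLex z.2 i : ℕ) : ℤ)) - (fun i : Fin 2 => ((ofLex z.1 i : ℕ) : ℤ))) / Real.sqrt 2 : ℝ) : ℂ))) z • bondPair z.1 z.2) + (∑ z : FermionTorus 2 M × FermionTorus 2 M, (fun z : FermionTorus 2 M × FermionTorus 2 M => (((dWaveFormFactor ((fun i : Fin 2 => ((ofLex z.2 i : ℕ) : ℤ)) - (fun i : Fin 2 => ((ofLex z.1 i : ℕ) : ℤ))) / Real.sqrt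 2 : ℝ) : ℂ))) z • bondPair z.1 z.2)ᴴ))) + onSiteSum (U : ℂ) (μs : ℂ) ((blocks.biUnion fun c => ((Finset.univ : Finset (FermionTorus 2 M)).map (f c).toEmbedding))ᶜ))‖ ≤ 256 * (1 + |h|) * ((L : ℝ) ^ 2 / M + L * M) := by
      have hsplit : dWaveSourceTorus L U μs h - ((∑ c ∈ blocks, jwEmbed (orbEmb (f c)) (hamiltonianWith ((zdGraph 2).comap (fun x : FermionTorus 2 M => fun i : Fin 2 => ((ofLex x i : ℕ) : ℤ))) 1 U μs - (h : ℂ) • ((∑ z : FermionTorus 2 M × FermionTorus 2 M, (fun z : FermionTorus 2 M × FermionTorus 2 M => (((dWaveFormFactor ((fun i : Fin 2 => ((ofLex z.2 i : ℕ) : ℤ)) - (fun i : Fin 2 => ((ofLex z.1 i : ℕ) : ℤ))) / Real.sqrt 2 : ℝ) : ℂ))) z • bondPair z.1 z.2) + (∑ z : FermionTorus 2 M × FermionTorus 2 M, (fun z : FermionTorus 2 M × FermionTorus 2 M => (((dWaveFormFactor ((fun i : Fin 2 => ((ofLex z.2 i : ℕ) : ℤ)) - (fun i : Fin 2 => ((ofLex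 z.1 i : ℕ) : ℤ))) / Real.sqrt 2 : ℝ) : ℂ))) z • bondPair z.1 z.2)ᴴ))) + onSiteSum (U : ℂ) (μs : ℂ) ((blocks.biUnion fun c => ((Finset.univ : Finset (FermionTorus 2 M)).map (f c).toEmbedding))ᶜ)) = (dWaveSourceTorus L U μs h - (hamiltonianWith ((zdGraph 2).comap (fun x : FermionTorus 2 L => fun i : Fin 2 => ((ofLex x i : ℕ) : ℤ))) 1 U μs - (h : ℂ) • ((∑ z : FermionTorus 2 L × FermionTorus 2 L, (fun z : FermionTorus 2 L × FermionTorus 2 L => (((dWaveFormFactor ((fun i : Fin 2 => ((ofLex z.2 i : ℕ) : ℤ)) - (fun i : Fin 2 => ((ofLex z.1 i : ℕ) : ℤ))) / Real.sqrt 2 : ℝ) : ℂ))) z • bondPair z.1 z.2) + (∑ z : FermionTorus 2 L × FermionTorus 2 L, (fun z : FermionTorus 2 L × FermionTorus 2 L => (((dWaveFormFactor ((fun i : Fin 2 => ((ofLex z.2 i : ℕ) : ℤ)) - (fun i : Fin 2 => ((ofLex z.1 i : ℕ) : ℤ))) / Real.sqrt 2 : ℝ) : ℂ))) z • bondPair z.1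 z.2)ᴴ))) +
          ((hamiltonianWith ((zdGraph 2).comap (fun x : FermionTorus 2 L => fun i : Fin 2 => ((ofLex x i : ℕ) : ℤ))) 1 U μs - (h : ℂ) • ((∑ z : FermionTorus 2 L × FermionTorus 2 L, (fun z : FermionTorus 2 L × FermionTorus 2 L => (((dWaveFormFactor ((fun i : Fin 2 => ((ofLex z.2 i : ℕ) : ℤ)) - (fun i : Fin 2 => ((ofLex z.1 i : ℕ) : ℤ))) / Real.sqrt 2 : ℝ) : ℂ))) z • bondPair z.1 z.2) + (∑ z : FermionTorus 2 L × FermionTorus 2 L, (fun z : FermionTorus 2 L × FermionTorus 2 L => (((dWaveFormFactor ((fun i : Fin 2 => ((ofLex z.2 i : ℕ) : ℤ)) - (fun i : Fin 2 => ((ofLex z.1 i : ℕ) : ℤ))) / Real.sqrt 2 : ℝ) : ℂ))) z • bondPair z.1 z.2)ᴴ)) - (∑ c ∈ blocks, jwEmbed (orbEmb (f c)) (hamiltonianWith ((zdGraph 2).comap (fun x : FermionTorus 2 M => fun i : Fin 2 => ((ofLex x i : ℕ) : ℤ))) 1 U μs - (h : ℂ) • ((∑ z : FermionTorus 2 M ×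 FermionTorus 2 M, (fun z : FermionTorus 2 M × FermionTorus 2 M => (((dWaveFormFactor ((fun i : Fin 2 => ((ofLex z.2 i : ℕ) : ℤ)) - (fun i : Fin 2 => ((ofLex z.1 i : ℕ) : ℤ))) / Real.sqrt 2 : ℝ) : ℂ))) z • bondPair z.1 z.2) + (∑ z : FermionTorus 2 M × FermionTorus 2 M, (fun z : FermionTorus 2 M × FermionTorus 2 M => (((dWaveFormFactor ((fun i : Fin 2 => ((ofLex z.2 i : ℕ) : ℤ)) - (fun i : Fin 2 => ((ofLex z.1 i : ℕ) : ℤ))) / Real.sqrt 2 : ℝ) : ℂ))) z • bondPair z.1 z.2)ᴴ))) - onSiteSum (U : ℂ) (μs : ℂ) ((blocks.biUnion fun c => ((Finset.univ : Finset (FermionTorus 2 M)).map (f c).toEmbedding))ᶜ)) := by abel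
      rw [hsplit]
      refine (norm_add_le _ _).trans ((add_le_add hE1 hE2).trans ?_)
      linarith only [hb2, hb3, hb4]
    -- assemble: expectations are linear, real multiples pull out
    have hadd : ∀ X Y : Matrix (Finset (Orb (FermionTorus 2 L))) (Finset (Orb (FermionTorus 2 L))) ℂ,
        (Matrix.gibbsState β (((∑ c ∈ blocks, jwEmbed (orbEmb (f c)) (hamiltonianWith ((zdGraph 2).comap (fun x : FermionTorus 2 M => fun i : Fin 2 => ((ofLex x i : ℕ) : ℤ))) 1 U 0 - (h : ℂ) • ((∑ z : FermionTorus 2 M × FermionTorus 2 M, (fun z : FermionTorus 2 M × FermionTorus 2 M => (((dWaveFormFactor ((fun i : Fin 2 => ((ofLex z.2 i : ℕ) : ℤ)) - (fun i : Fin 2 => ((ofLex z.1 i : ℕ) : ℤ))) / Real.sqrt 2 : ℝ) : ℂ))) z • bondPair z.1 z.2) + (∑ z : FermionTorus 2 M × FermionTorus 2 M, (fun z : FermionTorus 2 M × FermionTorus 2 M => (((dWaveFormFactor ((fun i : Fin 2 => ((ofLex z.2 i : ℕ) : ℤ)) - (fun i : Fin 2 => ((ofLex z.1 i : ℕ) :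 ℤ))) / Real.sqrt 2 : ℝ) : ℂ))) z • bondPair z.1 z.2)ᴴ))) + onSiteSum (U : ℂ) 0 ((blocks.biUnion fun c => ((Finset.univ : Finset (FermionTorus 2 M)).map (f c).toEmbedding))ᶜ)) - (μA : ℂ) • (Matrix.diagonal fun s : Finset (Orb (FermionTorus 2 L)) => (((s ∩ ((orbs (TA.biUnion fun c => ((Finset.univ : Finset (FermionTorus 2 M)).map (f c).toEmbedding))))).card : ℕ) : ℂ)) - (μB : ℂ) • (Matrix.diagonal fun s : Finset (Orb (FermionTorus 2 L)) => (((s ∩ ((orbs (TB.biUnion fun c => ((Finset.univ : Finset (FermionTorus 2 M)).map (f c).toEmbedding))))).card : ℕ) : ℂ)) - (μs : ℂ) • (Matrix.diagonal fun s : Finset (Orb (FermionTorus 2 L)) => (((s ∩ (orbs ((blocks.biUnion fun c => ((Finset.univ : Finset (FermionTorus 2 M)).map (f c).toEmbedding))ᶜ))).card : ℕ) : ℂ))) (X + Y)).re = (Matrix.gibbsState β (((∑ c ∈ blocks, jwEmbed (orbEmb (f c)) (hamiltonianWith ((zdGraph 2).comap (fun x : FermionTorus 2 M => fun i : Fin 2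 => ((ofLex x i : ℕ) : ℤ))) 1 U 0 - (h : ℂ) • ((∑ z : FermionTorus 2 M × FermionTorus 2 M, (fun z : FermionTorus 2 M × FermionTorus 2 M => (((dWaveFormFactor ((fun i : Fin 2 => ((ofLex z.2 i : ℕ) : ℤ)) - (fun i : Fin 2 => ((ofLex z.1 i : ℕ) : ℤ))) / Real.sqrt 2 : ℝ) : ℂ))) z • bondPair z.1 z.2) + (∑ z : FermionTorus 2 M × FermionTorus 2 M, (fun z : FermionTorus 2 M × FermionTorus 2 M => (((dWaveFormFactor ((fun i : Fin 2 => ((ofLex z.2 i : ℕ) : ℤ)) - (fun i : Fin 2 => ((ofLex z.1 i : ℕ) : ℤ))) / Real.sqrt 2 : ℝ) : ℂ))) z • bondPair z.1 z.2)ᴴ))) + onSiteSum (U : ℂ) 0 ((blocks.biUnion fun c => ((Finset.univ : Finset (FermionTorus 2 M)).map (f c).toEmbedding))ᶜ)) - (μA : ℂ) • (Matrix.diagonal fun s : Finset (Orb (FermionTorus 2 L)) => (((s ∩ ((orbs (TA.biUnion fun c => ((Finset.univ : Finset (FermionTorus 2 M)).map (f c).toEmbedding))))).card : ℕ) : ℂ))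 - (μB : ℂ) • (Matrix.diagonal fun s : Finset (Orb (FermionTorus 2 L)) => (((s ∩ ((orbs (TB.biUnion fun c => ((Finset.univ : Finset (FermionTorus 2 M)).map (f c).toEmbedding))))).card : ℕ) : ℂ)) - (μs : ℂ) • (Matrix.diagonal fun s : Finset (Orb (FermionTorus 2 L)) => (((s ∩ (orbs ((blocks.biUnion fun c => ((Finset.univ : Finset (FermionTorus 2 M)).map (f c).toEmbedding))ᶜ))).card : ℕ) : ℂ))) X).re + (Matrix.gibbsState β (((∑ c ∈ blocks, jwEmbed (orbEmb (f c)) (hamiltonianWith ((zdGraph 2).comap (fun x : FermionTorus 2 M => fun i : Fin 2 => ((ofLex x i : ℕ) : ℤ))) 1 U 0 - (h : ℂ) • ((∑ z : FermionTorus 2 M × FermionTorus 2 M, (fun z : FermionTorus 2 M × FermionTorus 2 M => (((dWaveFormFactor ((fun i : Fin 2 => ((ofLex z.2 i : ℕ) : ℤ)) - (fun i : Fin 2 => ((ofLex z.1 i : ℕ) : ℤ))) / Real.sqrt 2 : ℝ) : ℂ))) z • bondPair z.1 z.2) + (∑ z : FermionTorus 2 M × FermionTorus 2 M, (fun z : FermionTorus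 2 M × FermionTorus 2 M => (((dWaveFormFactor ((fun i : Fin 2 => ((ofLex z.2 i : ℕ) : ℤ)) - (fun i : Fin 2 => ((ofLex z.1 i : ℕ) : ℤ))) / Real.sqrt 2 : ℝ) : ℂ))) z • bondPair z.1 z.2)ᴴ))) + onSiteSum (U : ℂ) 0 ((blocks.biUnion fun c => ((Finset.univ : Finset (FermionTorus 2 M)).map (f c).toEmbedding))ᶜ)) - (μA : ℂ) • (Matrix.diagonal fun s : Finset (Orb (FermionTorus 2 L)) => (((s ∩ ((orbs (TA.biUnion fun c => ((Finset.univ : Finset (FermionTorus 2 M)).map (f c).toEmbedding))))).card : ℕ) : ℂ)) - (μB : ℂ) • (Matrix.diagonal fun s : Finset (Orb (FermionTorus 2 L)) => (((s ∩ ((orbs (TB.biUnion fun c => ((Finset.univ : Finset (FermionTorus 2 M)).map (f c).toEmbedding))))).card : ℕ) : ℂ)) - (μs : ℂ) • (Matrix.diagonal fun s : Finset (Orb (FermionTorus 2 L)) => (((s ∩ (orbs ((blocks.biUnion fun c => ((Finset.univ : Finset (FermionTorus 2 M)).map (f c).toEmbedding))ᶜ))).card : ℕ) : ℂ))) Y).re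 :=
      fun X Y => by rw [map_add, Complex.add_re]
    have e0 : (Matrix.gibbsState β (((∑ c ∈ blocks, jwEmbed (orbEmb (f c)) (hamiltonianWith ((zdGraph 2).comap (fun x : FermionTorus 2 M => fun i : Fin 2 => ((ofLex x i : ℕ) : ℤ))) 1 U 0 - (h : ℂ) • ((∑ z : FermionTorus 2 M × FermionTorus 2 M, (fun z : FermionTorus 2 M × FermionTorus 2 M => (((dWaveFormFactor ((fun i : Fin 2 => ((ofLex z.2 i : ℕ) : ℤ)) - (fun i : Fin 2 => ((ofLex z.1 i : ℕ) : ℤ))) / Real.sqrt 2 : ℝ) : ℂ))) z • bondPair z.1 z.2) + (∑ z : FermionTorus 2 M × FermionTorus 2 M, (fun z : FermionTorus 2 M × FermionTorus 2 M => (((dWaveFormFactor ((fun i : Fin 2 => ((ofLex z.2 i : ℕ) : ℤ)) - (fun i : Fin 2 => ((ofLex z.1 i : ℕ) : ℤ))) / Real.sqrt 2 : ℝ) : ℂ))) z • bondPair z.1 z.2)ᴴ))) + onSiteSum (U : ℂ) 0 ((blocks.biUnion fun c => ((Finset.univ : Finset (FermionTorus 2 M)).map (f c).toEmbedding))ᶜ))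 - (μA : ℂ) • (Matrix.diagonal fun s : Finset (Orb (FermionTorus 2 L)) => (((s ∩ ((orbs (TA.biUnion fun c => ((Finset.univ : Finset (FermionTorus 2 M)).map (f c).toEmbedding))))).card : ℕ) : ℂ)) - (μB : ℂ) • (Matrix.diagonal fun s : Finset (Orb (FermionTorus 2 L)) => (((s ∩ ((orbs (TB.biUnion fun c => ((Finset.univ : Finset (FermionTorus 2 M)).map (f c).toEmbedding))))).card : ℕ) : ℂ)) - (μs : ℂ) • (Matrix.diagonal fun s : Finset (Orb (FermionTorus 2 L)) => (((s ∩ (orbs ((blocks.biUnion fun c => ((Finset.univ : Finset (FermionTorus 2 M)).map (f c).toEmbedding))ᶜ))).card : ℕ) : ℂ))) ((hubbardTorusWith 2 L 1 U μs - ((g / (L : ℝ) ^ 2 : ℝ) : ℂ) • ((pairField dWaveFormFactor L)ᴴ * pairField dWaveFormFactor L)) - (((∑ c ∈ blocks, jwEmbed (orbEmb (f c)) (hamiltonianWith ((zdGraph 2).comap (fun x : FermionTorus 2 M => fun i : Fin 2 => ((ofLex x i : ℕ) : ℤ))) 1 U 0 - (h : ℂ) • ((∑ z : FermionTorus 2 M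 × FermionTorus 2 M, (fun z : FermionTorus 2 M × FermionTorus 2 M => (((dWaveFormFactor ((fun i : Fin 2 => ((ofLex z.2 i : ℕ) : ℤ)) - (fun i : Fin 2 => ((ofLex z.1 i : ℕ) : ℤ))) / Real.sqrt 2 : ℝ) : ℂ))) z • bondPair z.1 z.2) + (∑ z : FermionTorus 2 M × FermionTorus 2 M, (fun z : FermionTorus 2 M × FermionTorus 2 M => (((dWaveFormFactor ((fun i : Fin 2 => ((ofLex z.2 i : ℕ) : ℤ)) - (fun i : Fin 2 => ((ofLex z.1 i : ℕ) : ℤ))) / Real.sqrt 2 : ℝ) : ℂ))) z • bondPair z.1 z.2)ᴴ))) + onSiteSum (U : ℂ) 0 ((blocks.biUnion fun c => ((Finset.univ : Finset (FermionTorus 2 M)).map (f c).toEmbedding))ᶜ)) - (μA : ℂ) • (Matrix.diagonal fun s : Finset (Orb (FermionTorus 2 L)) => (((s ∩ ((orbs (TA.biUnion fun c => ((Finset.univ : Finset (FermionTorus 2 M)).map (f c).toEmbedding))))).card : ℕ) : ℂ)) - (μB : ℂ) • (Matrix.diagonal fun s : Finset (Orb (FermionTorus 2 L)) => (((s ∩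 ((orbs (TB.biUnion fun c => ((Finset.univ : Finset (FermionTorus 2 M)).map (f c).toEmbedding))))).card : ℕ) : ℂ)) - (μs : ℂ) • (Matrix.diagonal fun s : Finset (Orb (FermionTorus 2 L)) => (((s ∩ (orbs ((blocks.biUnion fun c => ((Finset.univ : Finset (FermionTorus 2 M)).map (f c).toEmbedding))ᶜ))).card : ℕ) : ℂ))))).re =
        (Matrix.gibbsState β (((∑ c ∈ blocks, jwEmbed (orbEmb (f c)) (hamiltonianWith ((zdGraph 2).comap (fun x : FermionTorus 2 M => fun i : Fin 2 => ((ofLex x i : ℕ) : ℤ))) 1 U 0 - (h : ℂ) • ((∑ z : FermionTorus 2 M × FermionTorus 2 M, (fun z : FermionTorus 2 M × FermionTorus 2 M => (((dWaveFormFactor ((fun i : Fin 2 => ((ofLex z.2 i : ℕ) : ℤ)) - (fun i : Fin 2 => ((ofLex z.1 i : ℕ) : ℤ))) / Real.sqrt 2 : ℝ) : ℂ))) z • bondPair z.1 z.2) + (∑ z : FermionTorus 2 M × FermionTorus 2 M, (fun z : FermionTorus 2 M × FermionTorus 2 M => (((dWaveFormFactor ((fun i : Fin 2 => ((ofLex z.2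 i : ℕ) : ℤ)) - (fun i : Fin 2 => ((ofLex z.1 i : ℕ) : ℤ))) / Real.sqrt 2 : ℝ) : ℂ))) z • bondPair z.1 z.2)ᴴ))) + onSiteSum (U : ℂ) 0 ((blocks.biUnion fun c => ((Finset.univ : Finset (FermionTorus 2 M)).map (f c).toEmbedding))ᶜ)) - (μA : ℂ) • (Matrix.diagonal fun s : Finset (Orb (FermionTorus 2 L)) => (((s ∩ ((orbs (TA.biUnion fun c => ((Finset.univ : Finset (FermionTorus 2 M)).map (f c).toEmbedding))))).card : ℕ) : ℂ)) - (μB : ℂ) • (Matrix.diagonal fun s : Finset (Orb (FermionTorus 2 L)) => (((s ∩ ((orbs (TB.biUnion fun c => ((Finset.univ : Finset (FermionTorus 2 M)).map (f c).toEmbedding))))).card : ℕ) : ℂ)) - (μs : ℂ) • (Matrix.diagonal fun s : Finset (Orb (FermionTorus 2 L)) => (((s ∩ (orbs ((blocks.biUnion fun c => ((Finset.univ : Finset (FermionTorus 2 M)).map (f c).toEmbedding))ᶜ))).card : ℕ) : ℂ))) ((-(((g / (L : ℝ) ^ 2 : ℝ) : ℂ) • ((pairField dWaveFormFactor L)ᴴ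 * pairField dWaveFormFactor L)) + (h : ℂ) • (pairField dWaveFormFactor L + (pairField dWaveFormFactor L)ᴴ)) + (dWaveSourceTorus L U μs h - ((∑ c ∈ blocks, jwEmbed (orbEmb (f c)) (hamiltonianWith ((zdGraph 2).comap (fun x : FermionTorus 2 M => fun i : Fin 2 => ((ofLex x i : ℕ) : ℤ))) 1 U μs - (h : ℂ) • ((∑ z : FermionTorus 2 M × FermionTorus 2 M, (fun z : FermionTorus 2 M × FermionTorus 2 M => (((dWaveFormFactor ((fun i : Fin 2 => ((ofLex z.2 i : ℕ) : ℤ)) - (fun i : Fin 2 => ((ofLex z.1 i : ℕ) : ℤ))) / Real.sqrt 2 : ℝ) : ℂ))) z • bondPair z.1 z.2) + (∑ z : FermionTorus 2 M × FermionTorus 2 M, (fun z : FermionTorus 2 M × FermionTorus 2 M => (((dWaveFormFactor ((fun i : Fin 2 => ((ofLex z.2 i : ℕ) : ℤ)) - (fun i : Fin 2 => ((ofLex z.1 i : ℕ) : ℤ))) / Real.sqrt 2 : ℝ) : ℂ))) z • bondPair z.1 z.2)ᴴ))) + onSiteSum (U : ℂ) (μs : ℂ) ((blocks.biUnion fun c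 => ((Finset.univ : Finset (FermionTorus 2 M)).map (f c).toEmbedding))ᶜ))) + ((μA - μs : ℝ) : ℂ) • (Matrix.diagonal fun s : Finset (Orb (FermionTorus 2 L)) => (((s ∩ ((orbs (TA.biUnion fun c => ((Finset.univ : Finset (FermionTorus 2 M)).map (f c).toEmbedding))))).card : ℕ) : ℂ)) + ((μB - μs : ℝ) : ℂ) • (Matrix.diagonal fun s : Finset (Orb (FermionTorus 2 L)) => (((s ∩ ((orbs (TB.biUnion fun c => ((Finset.univ : Finset (FermionTorus 2 M)).map (f c).toEmbedding))))).card : ℕ) : ℂ)))).re :=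
      congrArg (fun X => (Matrix.gibbsState β (((∑ c ∈ blocks, jwEmbed (orbEmb (f c)) (hamiltonianWith ((zdGraph 2).comap (fun x : FermionTorus 2 M => fun i : Fin 2 => ((ofLex x i : ℕ) : ℤ))) 1 U 0 - (h : ℂ) • ((∑ z : FermionTorus 2 M × FermionTorus 2 M, (fun z : FermionTorus 2 M × FermionTorus 2 M => (((dWaveFormFactor ((fun i : Fin 2 => ((ofLex z.2 i : ℕ) : ℤ)) - (fun i : Fin 2 => ((ofLex z.1 i : ℕ) : ℤ))) / Real.sqrt 2 : ℝ) : ℂ))) z • bondPair z.1 z.2) + (∑ z : FermionTorus 2 M × FermionTorus 2 M, (fun z : FermionTorus 2 M × FermionTorus 2 M => (((dWaveFormFactor ((fun i : Fin 2 => ((ofLex z.2 i : ℕ) : ℤ)) - (fun i : Fin 2 => ((ofLex z.1 i : ℕ) : ℤ))) / Real.sqrt 2 : ℝ) : ℂ))) z • bondPair z.1 z.2)ᴴ))) + onSiteSum (U : ℂ) 0 ((blocks.biUnion fun c => ((Finset.univ : Finset (FermionTorus 2 M)).map (f c).toEmbedding))ᶜ)) - (μA : ℂ) • (Matrix.diagonal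 fun s : Finset (Orb (FermionTorus 2 L)) => (((s ∩ ((orbs (TA.biUnion fun c => ((Finset.univ : Finset (FermionTorus 2 M)).map (f c).toEmbedding))))).card : ℕ) : ℂ)) - (μB : ℂ) • (Matrix.diagonal fun s : Finset (Orb (FermionTorus 2 L)) => (((s ∩ ((orbs (TB.biUnion fun c => ((Finset.univ : Finset (FermionTorus 2 M)).map (f c).toEmbedding))))).card : ℕ) : ℂ)) - (μs : ℂ) • (Matrix.diagonal fun s : Finset (Orb (FermionTorus 2 L)) => (((s ∩ (orbs ((blocks.biUnion fun c => ((Finset.univ : Finset (FermionTorus 2 M)).map (f c).toEmbedding))ᶜ))).card : ℕ) : ℂ))) X).re) hdec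
    have e1 := hadd ((-(((g / (L : ℝ) ^ 2 : ℝ) : ℂ) • ((pairField dWaveFormFactor L)ᴴ * pairField dWaveFormFactor L)) + (h : ℂ) • (pairField dWaveFormFactor L + (pairField dWaveFormFactor L)ᴴ)) + (dWaveSourceTorus L U μs h - ((∑ c ∈ blocks, jwEmbed (orbEmb (f c)) (hamiltonianWith ((zdGraph 2).comap (fun x : FermionTorus 2 M => fun i : Fin 2 => ((ofLex x i : ℕ) : ℤ))) 1 U μs - (h : ℂ) • ((∑ z : FermionTorus 2 M × FermionTorus 2 M, (fun z : FermionTorus 2 M × FermionTorus 2 M => (((dWaveFormFactor ((fun i : Fin 2 => ((ofLex z.2 i : ℕ) : ℤ)) - (fun i : Fin 2 => ((ofLex z.1 i : ℕ) : ℤ))) / Real.sqrt 2 : ℝ) : ℂ))) z • bondPair z.1 z.2) + (∑ z : FermionTorus 2 M × FermionTorus 2 M, (fun z : FermionTorus 2 M × FermionTorus 2 M => (((dWaveFormFactor ((fun i : Fin 2 => ((ofLex z.2 i : ℕ) : ℤ)) - (fun i : Fin 2 => ((ofLex z.1 i : ℕ) : ℤ))) / Real.sqrt 2 : ℝ) :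 ℂ))) z • bondPair z.1 z.2)ᴴ))) + onSiteSum (U : ℂ) (μs : ℂ) ((blocks.biUnion fun c => ((Finset.univ : Finset (FermionTorus 2 M)).map (f c).toEmbedding))ᶜ))) + ((μA - μs : ℝ) : ℂ) • (Matrix.diagonal fun s : Finset (Orb (FermionTorus 2 L)) => (((s ∩ ((orbs (TA.biUnion fun c => ((Finset.univ : Finset (FermionTorus 2 M)).map (f c).toEmbedding))))).card : ℕ) : ℂ))) (((μB - μs : ℝ) : ℂ) • (Matrix.diagonal fun s : Finset (Orb (FermionTorus 2 L)) => (((s ∩ ((orbs (TB.biUnion fun c => ((Finset.univ : Finset (FermionTorus 2 M)).map (f c).toEmbedding))))).card : ℕ) : ℂ)))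
    have e2 := hadd ((-(((g / (L : ℝ) ^ 2 : ℝ) : ℂ) • ((pairField dWaveFormFactor L)ᴴ * pairField dWaveFormFactor L)) + (h : ℂ) • (pairField dWaveFormFactor L + (pairField dWaveFormFactor L)ᴴ)) + (dWaveSourceTorus L U μs h - ((∑ c ∈ blocks, jwEmbed (orbEmb (f c)) (hamiltonianWith ((zdGraph 2).comap (fun x : FermionTorus 2 M => fun i : Fin 2 => ((ofLex x i : ℕ) : ℤ))) 1 U μs - (h : ℂ) • ((∑ z : FermionTorus 2 M × FermionTorus 2 M, (fun z : FermionTorus 2 M × FermionTorus 2 M => (((dWaveFormFactor ((fun i : Fin 2 => ((ofLex z.2 i : ℕ) : ℤ)) - (fun i : Fin 2 => ((ofLex z.1 i : ℕ) : ℤ))) / Real.sqrt 2 : ℝ) : ℂ))) z • bondPair z.1 z.2) + (∑ z : FermionTorus 2 M × FermionTorus 2 M, (fun z : FermionTorus 2 M × FermionTorus 2 M => (((dWaveFormFactor ((fun i : Fin 2 => ((ofLex z.2 i : ℕ) : ℤ)) - (fun i : Fin 2 => ((ofLex z.1 i : ℕ) : ℤ))) / Real.sqrt 2 : ℝ) :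 ℂ))) z • bondPair z.1 z.2)ᴴ))) + onSiteSum (U : ℂ) (μs : ℂ) ((blocks.biUnion fun c => ((Finset.univ : Finset (FermionTorus 2 M)).map (f c).toEmbedding))ᶜ)))) (((μA - μs : ℝ) : ℂ) • (Matrix.diagonal fun s : Finset (Orb (FermionTorus 2 L)) => (((s ∩ ((orbs (TA.biUnion fun c => ((Finset.univ : Finset (FermionTorus 2 M)).map (f c).toEmbedding))))).card : ℕ) : ℂ)))
    have e3 := hadd (-(((g / (L : ℝ) ^ 2 : ℝ) : ℂ) • ((pairField dWaveFormFactor L)ᴴ * pairField dWaveFormFactor L)) + (h : ℂ) • (pairField dWaveFormFactor L + (pairField dWaveFormFactor L)ᴴ)) (dWaveSourceTorus L U μs h - ((∑ c ∈ blocks, jwEmbed (orbEmb (f c)) (hamiltonianWith ((zdGraph 2).comap (fun x : FermionTorus 2 M => fun i : Fin 2 => ((ofLex x i : ℕ) : ℤ))) 1 U μs - (h : ℂ) • ((∑ z : FermionTorus 2 M × FermionTorus 2 M, (fun z : FermionTorus 2 M × FermionTorus 2 M => (((dWaveFormFactor ((fun i : Fin 2 => ((ofLex z.2 i : ℕ)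 : ℤ)) - (fun i : Fin 2 => ((ofLex z.1 i : ℕ) : ℤ))) / Real.sqrt 2 : ℝ) : ℂ))) z • bondPair z.1 z.2) + (∑ z : FermionTorus 2 M × FermionTorus 2 M, (fun z : FermionTorus 2 M × FermionTorus 2 M => (((dWaveFormFactor ((fun i : Fin 2 => ((ofLex z.2 i : ℕ) : ℤ)) - (fun i : Fin 2 => ((ofLex z.1 i : ℕ) : ℤ))) / Real.sqrt 2 : ℝ) : ℂ))) z • bondPair z.1 z.2)ᴴ))) + onSiteSum (U : ℂ) (μs : ℂ) ((blocks.biUnion fun c => ((Finset.univ : Finset (FermionTorus 2 M)).map (f c).toEmbedding))ᶜ)))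
    have e4 := re_gibbsState_real_smul β (((∑ c ∈ blocks, jwEmbed (orbEmb (f c)) (hamiltonianWith ((zdGraph 2).comap (fun x : FermionTorus 2 M => fun i : Fin 2 => ((ofLex x i : ℕ) : ℤ))) 1 U 0 - (h : ℂ) • ((∑ z : FermionTorus 2 M × FermionTorus 2 M, (fun z : FermionTorus 2 M × FermionTorus 2 M => (((dWaveFormFactor ((fun i : Fin 2 => ((ofLex z.2 i : ℕ) : ℤ)) - (fun i : Fin 2 => ((ofLex z.1 i : ℕ) : ℤ))) / Real.sqrt 2 : ℝ) : ℂ))) z • bondPair z.1 z.2) + (∑ z : FermionTorus 2 M × FermionTorus 2 M, (fun z : FermionTorus 2 M × FermionTorus 2 M => (((dWaveFormFactor ((fun i : Fin 2 => ((ofLex z.2 i : ℕ) : ℤ)) - (fun i : Fin 2 => ((ofLex z.1 i : ℕ) : ℤ))) / Real.sqrt 2 : ℝ) : ℂ))) z • bondPair z.1 z.2)ᴴ))) + onSiteSum (U : ℂ) 0 ((blocks.biUnion fun c => ((Finset.univ : Finset (FermionTorus 2 M)).map (f c).toEmbedding))ᶜ)) - (μA : ℂ) • (Matrix.diagonal fun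 s : Finset (Orb (FermionTorus 2 L)) => (((s ∩ ((orbs (TA.biUnion fun c => ((Finset.univ : Finset (FermionTorus 2 M)).map (f c).toEmbedding))))).card : ℕ) : ℂ)) - (μB : ℂ) • (Matrix.diagonal fun s : Finset (Orb (FermionTorus 2 L)) => (((s ∩ ((orbs (TB.biUnion fun c => ((Finset.univ : Finset (FermionTorus 2 M)).map (f c).toEmbedding))))).card : ℕ) : ℂ)) - (μs : ℂ) • (Matrix.diagonal fun s : Finset (Orb (FermionTorus 2 L)) => (((s ∩ (orbs ((blocks.biUnion fun c => ((Finset.univ : Finset (FermionTorus 2 M)).map (f c).toEmbedding))ᶜ))).card : ℕ) : ℂ))) (Matrix.diagonal fun s : Finset (Orb (FermionTorus 2 L)) => (((s ∩ ((orbs (TA.biUnion fun c => ((Finset.univ : Finset (FermionTorus 2 M)).map (f c).toEmbedding))))).card : ℕ) : ℂ)) (μA - μs)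
    have e5 := re_gibbsState_real_smul β (((∑ c ∈ blocks, jwEmbed (orbEmb (f c)) (hamiltonianWith ((zdGraph 2).comap (fun x : FermionTorus 2 M => fun i : Fin 2 => ((ofLex x i : ℕ) : ℤ))) 1 U 0 - (h : ℂ) • ((∑ z : FermionTorus 2 M × FermionTorus 2 M, (fun z : FermionTorus 2 M × FermionTorus 2 M => (((dWaveFormFactor ((fun i : Fin 2 => ((ofLex z.2 i : ℕ) : ℤ)) - (fun i : Fin 2 => ((ofLex z.1 i : ℕ) : ℤ))) / Real.sqrt 2 : ℝ) : ℂ))) z • bondPair z.1 z.2) + (∑ z : FermionTorus 2 M × FermionTorus 2 M, (fun z : FermionTorus 2 M × FermionTorus 2 M => (((dWaveFormFactor ((fun i : Fin 2 => ((ofLex z.2 i : ℕ) : ℤ)) - (fun i : Fin 2 => ((ofLex z.1 i : ℕ) : ℤ))) / Real.sqrt 2 : ℝ) : ℂ))) z • bondPair z.1 z.2)ᴴ))) + onSiteSum (U : ℂ) 0 ((blocks.biUnion fun c => ((Finset.univ : Finset (FermionTorus 2 M)).map (f c).toEmbedding))ᶜ)) - (μA : ℂ) • (Matrix.diagonal fun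 s : Finset (Orb (FermionTorus 2 L)) => (((s ∩ ((orbs (TA.biUnion fun c => ((Finset.univ : Finset (FermionTorus 2 M)).map (f c).toEmbedding))))).card : ℕ) : ℂ)) - (μB : ℂ) • (Matrix.diagonal fun s : Finset (Orb (FermionTorus 2 L)) => (((s ∩ ((orbs (TB.biUnion fun c => ((Finset.univ : Finset (FermionTorus 2 M)).map (f c).toEmbedding))))).card : ℕ) : ℂ)) - (μs : ℂ) • (Matrix.diagonal fun s : Finset (Orb (FermionTorus 2 L)) => (((s ∩ (orbs ((blocks.biUnion fun c => ((Finset.univ : Finset (FermionTorus 2 M)).map (f c).toEmbedding))ᶜ))).card : ℕ) : ℂ))) (Matrix.diagonal fun s : Finset (Orb (FermionTorus 2 L)) => (((s ∩ ((orbs (TB.biUnion fun c => ((Finset.univ : Finset (FermionTorus 2 M)).map (f c).toEmbedding))))).card : ℕ) : ℂ)) (μB - μs)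
    have h1 := re_gibbsState_pairing_le hKh β (pairField dWaveFormFactor L) hg (by positivity : (0 : ℝ) < (L : ℝ) ^ 2) h
    have h2 := re_gibbsState_le_norm hKh β (dWaveSourceTorus L U μs h - ((∑ c ∈ blocks, jwEmbed (orbEmb (f c)) (hamiltonianWith ((zdGraph 2).comap (fun x : FermionTorus 2 M => fun i : Fin 2 => ((ofLex x i : ℕ) : ℤ))) 1 U μs - (h : ℂ) • ((∑ z : FermionTorus 2 M × FermionTorus 2 M, (fun z : FermionTorus 2 M × FermionTorus 2 M => (((dWaveFormFactor ((fun i : Fin 2 => ((ofLex z.2 i : ℕ) : ℤ)) - (fun i : Fin 2 => ((ofLex z.1 i : ℕ) : ℤ))) / Real.sqrt 2 : ℝ) : ℂ))) z • bondPair z.1 z.2) + (∑ z : FermionTorus 2 M × FermionTorus 2 M, (fun z : FermionTorus 2 M × FermionTorus 2 M => (((dWaveFormFactor ((fun i : Fin 2 => ((ofLex z.2 i : ℕ) : ℤ)) - (fun i : Fin 2 => ((ofLex z.1 i : ℕ) : ℤ))) / Real.sqrt 2 : ℝ) : ℂ))) z • bondPair z.1 z.2)ᴴ))) + onSiteSum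 (U : ℂ) (μs : ℂ) ((blocks.biUnion fun c => ((Finset.univ : Finset (FermionTorus 2 M)).map (f c).toEmbedding))ᶜ)))
    linarith only [e0, e1, e2, e3, e4, e5, h1, h2, hWn]
end

end Summit.HubbardSuperconductivity.HubbardSuperconductivity.Theorems.TwSeededEnsembleEquivalenceR.ColdFloorLine
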